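import Literature.Geometry.Kaehler.ComplexTorusTotalLieAlgebra
import HarnessLib

/-!
# The Kähler Lie algebra of a complex torus is `𝔰𝔲(H₁(X; ℝ) ⊕ H¹(X; ℝ)‾)`
# (Looijenga–Lunts 1997, §3 Proposition (3.4))

Topic `Literature/Geometry/Kaehler`, namespace `Literature.Geometry.Kaehler.ComplexTorus`; lane `lit-hodgefound`
(Track 2 foundations library), Layer A1 «complex tori · H^k = ⋀^k H¹ · Hodge decomposition from V ⊗ ℂ = V ⊕ V̄»,
skeleton seat `lit-hodgefound-skel-1` (generation 17), row **A1-44** of `run/shared/lean/pub/lit-hodgefound/SKELETON.md`.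
It continues the two files of row A1-43: `LinearAlgebra/Alternating/ExteriorAlgebraSpinorRepresentation.lean`
(Looijenga–Lunts (3.1)–(3.2): `V ⊕ V^* = sumDual V`, the split form, `𝔰𝔬(V ⊕ V^*) = so V`, `ψ₂`, `ψ₋₂`, `ψ₀`, the
grading element `u`, the spinor representation `ρ = spinorRep V : so V →ₗ⁅ℝ⁆ End_ℂ(⋀^• V^* ⊗ ℂ)`, injective) and
`Geometry/Kaehler/ComplexTorusTotalLieAlgebra.lean` ((3.3): the total Lie algebra `𝔤_tot(X; ℝ) = totalLieAlgebra E`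
of the complex torus `X = E/Λ`, `V = H₁(X; ℝ) = E`, `H•(X, ℂ) = ⊕ₖ Alt^k_ℝ(E; ℂ) = GForm E ℂ`, and
`𝔤_tot = ρ(𝔰𝔬(V ⊕ V^*))`), all consumed BY NAME; here the complex structure of `X` enters.

## Source, verbatim (E. Looijenga, V. A. Lunts, *A Lie algebra attached to a projective variety*, Invent. Math.
129 (1997) 361–412 = arXiv:alg-geom/9604014; held corpus text `paper:arxiv-alg-geom_9604014` p0004 (§1 (1.1)),
p0006 ((1.9)), p0013 L117 – p0014 L19 (§3); arXiv PDF p. 25, where the proposition carries the number (3.4))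

* §1 (1.1): "We let `𝔤(𝔞, M)` denote the Lie subalgebra of `𝔤𝔩(M)` generated by the transformations `e_a, f_a`"
  (`e : 𝔞 → 𝔤𝔩(M)` on all of `𝔞`, `f_a` for the `a` with the Lefschetz property).
* (1.9): "If we want to take the complex structure into account, then it is more natural to regard `H(X)[n]` as
  module over `H^{1,1}(X)`. This is by 1.6 also a Lefschetz module structure. We shall refer to the associated Lie
  algebra as the Kähler Lie algebra of `X` and denote it by `𝔤_K(X)`."
* §3, after (3.3): "We now assume that `X` comes with a complex structure. We shall determine its Kähler Lie
  algebra. Let `V^*` resp. `V̄^*` denote the `ℝ`-dual of `V` equipped with the complex structure `J^*` resp. `-J^*`.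
  The quadratic form `q` defined above is invariant under the complex structure `(J, -J^*)` and so extends to a
  Hermitian form on `V ⊕ V̄^*`. Let `𝔰𝔲(V ⊕ V̄^*)` be the Lie algebra of the corresponding special unitary group.
  Since `u ∈ 𝔰𝔲(V ⊕ V̄^*)`, it inherits a grading with degrees `-2`, `0` and `2`. In fact, `(𝔰𝔲(V ⊕ V̄^*), u)` is
  a Jordan–Lefschetz pair. It is a real form of case `(A_{2n-1}, A_{n-1} + A_{n-1})`. The `J^*`-invariant elements
  of `⋀²_ℝ V^*` are precisely the real `(1,1)`-forms. So they make up the span of the Kähler classes of `X`. Now a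
  straightforward verification shows that `ψ` maps the `J`-invariants of `⋀²_ℝ V` resp. `J^*`-invariants of
  `⋀²_ℝ V^*` onto `𝔰𝔲(V ⊕ V̄^*)₋₂` resp. `𝔰𝔲(V ⊕ V̄^*)₂`. We have:"
* **(3.4) Proposition.** "There is a natural identification `(𝔤_K(X; ℝ), h) ≅ (𝔰𝔲(V ⊕ V̄^*), u)`; this is a
  real form of the case `(A_{2n-1}, A_{n-1} + A_{n-1})`. Furthermore, the subspace `⊕ₖ H^{k,k}(X)[n]` is a
  fundamental Jordan–Lefschetz module of `𝔤_K(X)`. *Proof.* The first assertion is clear from the preceding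
  discussion. […]"

## What is formalised (definitions with bodies; theorems; NO named fact, no `sorry`)

* §1 the complex structures `J = cxJ E` (`x ↦ i x` on `V = E`), `J^* = cxJt E` (`(J^*ξ)(x) = ξ(Jx)` on `V^*`) and
  **`𝒥 = cxStr E := (J, -J^*)`** on `V ⊕ V^* = sumDual E`; `𝒥² = -1` (`cxStr_mul_cxStr`); "`q` … is invariant under
  the complex structure `(J, -J^*)`": `splitForm_cxStr_cxStr`, equivalently `𝒥 ∈ 𝔰𝔬(V ⊕ V^*)` (`cxStr_mem_so`).
* §2 `Tr_ℝ J = Tr_ℝ J^* = 0` (`trace_cxJ`, `trace_cxJt`).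
* §3 **`su E` = `𝔰𝔲(V ⊕ V̄^*)`** on the real carrier: `{T ∈ 𝔰𝔬(V ⊕ V^*) | T𝒥 = 𝒥T, Tr_ℝ(𝒥T) = 0}` — a real
  endomorphism is in the unitary Lie algebra of the Hermitian extension `h` of `q` iff it is `𝒥`-linear and skew for
  `Re h = ` (polar form of) `q`; its complex trace is `½ Tr_ℝ T - (i/2) Tr_ℝ(𝒥T)` and `Tr_ℝ T = 0` on `𝔰𝔬`
  (`trace_eq_zero_of_mem_so`), so "special" is `Tr_ℝ(𝒥T) = 0`. A real Lie subalgebra (`su`, `mem_su_iff`, `su_le_so`);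
  "Since `u ∈ 𝔰𝔲(V ⊕ V̄^*)`": `gradingElement_mem_su`; as a Lie subalgebra of the tree's `so E`: `suSo E`.
* §4 "a straightforward verification": the degree-`2` element `upEnd κ = ψ₂(κ) : (x, ξ) ↦ (0, κ(x, ·))` of a real
  `2`-form `κ` (`psi2_eq_upEnd`: Looijenga–Lunts' `ψ₂(α ∧ β)`) lies in `𝔰𝔲` **iff `κ(iu, iv) = κ(u, v)`**
  (`upEnd_mem_su_iff`; "the `J^*`-invariant elements of `⋀²_ℝ V^*` are precisely the real `(1,1)`-forms" — the tree's
  `(1,1)` condition `IsNSForm.type_one_one` / `isOfTypeAt_one_one_ofRealForm`), and the degree-`-2` element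
  `lowEnd P = ψ₋₂(P) : (x, ξ) ↦ (Pξ, 0)` of a map `P : V^* → V` (`psiNeg2_eq_lowEnd`) lies in `𝔰𝔲` iff `P` is skew
  (a `2`-vector) and `P J^* = -J P` (the `2`-vector is `J`-invariant) (`lowEnd_mem_su_iff`). "Onto": every `T ∈ 𝔰𝔲`
  is `ψ₋₂(P) + ψ₀(σ) + ψ₂(κ)` with such `P` and `κ` (§9 `eq_blocks`, `blkP_skew`, `blkP_cxJt`, `formOfSkew_blkΦ_I_smul`).
* §5–§6 frames: `IsSymplecticBasis.eq_frameForm`, the sharp map `frameSharp b = κ_b⁻¹` with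
  `IsSymplecticBasis.flat_frameSharp`, `sum_psi2_eq_upEnd_frameForm`, `sum_psiNeg2_eq_lowEnd_frameSharp`,
  `IsSymplecticBasis.lowEnd_frameSharp_mem_su` (for a `(1,1)`-form `κ` the `2`-vector `κ⁻¹` is `J`-invariant); the frame
  expansion `κ = ½ ∑ᵢ bᵢ^* ∧ κ(bᵢ, ·)` (`ofRealForm_eq_half_sum`, `lefschetzPow_one_eq_half_sum`, `lefschetzG_eq_half_sum`)
  and **`spinorRepLin_upEnd : ρ(ψ₂(κ)) = e_κ = L_κ`** for EVERY real `2`-form `κ`.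
* §7 **`kaehlerLieAlgebra E`** `:= lieSpan_ℝ ({L_η | η real (1,1)-form} ∪ {Λ | IsSl2Triple h L_η Λ, η real (1,1)-form})`,
  (1.1)/(1.9) with `𝔞 = H^{1,1}(X) ∩ H²(X; ℝ)`, `M = H•(X, ℂ)`, `h = countingG E` (cf. `totalLieAlgebra E` for
  `𝔞 = H²(X; ℝ)`), with `kaehlerLieAlgebra_le_totalLieAlgebra`; the restriction `suRep E` of `ρ` to `𝔰𝔲` and
  **`kaehlerLieAlgebra_le_range`** (`𝔤_K ⊆ ρ(𝔰𝔲)`: `e_η = ρψ₂(η)`, `f_η = ∑ i_{a_{-k}} i_{a_k} = ρψ₋₂(η⁻¹)`).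
* §8 **`ρ(𝔰𝔲) ⊆ 𝔤_K`**, i.e. `𝔰𝔲` is generated by `𝔰𝔲₂` and the Lefschetz part of `𝔰𝔲₋₂` (the content of "the first
  assertion is clear", cf. the source's remark in the proof of (3.7) that "for a Jordan pair `(𝔤, h)`, `[𝔤₂, 𝔤₋₂]`
  generates `𝔤₀`"): the standard frame `(c_k, i c_k)` of a complex basis (`cxFrame`) and its Kähler form `ω₀`
  (`frameForm_cxFrame_I_smul`); `ad(ψ₋₂(P))² ψ₂(κ) = -2 ψ₋₂(P κ♭ P)` (`lie_lowEnd_lie_lowEnd_upEnd`) gives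
  `ρψ₋₂(P) ∈ 𝔤_K` for every `J`-invariant `2`-vector `P` (`spinorRepLin_lowEnd_mem_kaehlerLieAlgebra`);
  `[ψ₂(κ), ψ₋₂(P)] = ψ₀(κ♭ P)` (`lie_upEnd_lowEnd`, Looijenga–Lunts' `σ(a ∧ b, α ∧ β)`) and four explicit products
  (`flat_pairForm_*`: the complex matrix units of `𝔤𝔩_ℂ(V̄^*)`, the imaginary diagonal ones only through traceless
  differences) give `ρψ₀(σ) ∈ 𝔤_K` for every `σ` commuting with `J^*` with `Tr_ℝ(J^*σ) = 0`
  (`spinorRepLin_psi0_mem_kaehlerLieAlgebra`).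
* §9 the block decomposition `eq_blocks` of `𝔰𝔬(V ⊕ V^*)`, the block conditions of `𝔰𝔲` (`blkP_cxJt`, `blkD_cxJt`,
  `blkΦ_I_smul`, `trace_cxJt_blkD`), **`range_le_kaehlerLieAlgebra`**, and **(3.4)**: **`range_suRep_eq`**
  (`ρ(𝔰𝔲(V ⊕ V̄^*)) = 𝔤_K(X; ℝ)`), the Lie algebra isomorphism **`kaehlerLieAlgebraEquiv : suSo E ≃ₗ⁅ℝ⁆ kaehlerLieAlgebra E`**
  and **`u ↦ h`** (`kaehlerLieAlgebraEquiv_gradingElement`), for every complex torus of dimension `g ≥ 1`.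
* §10 the submodule half of the second assertion of (3.4): the circle action `rotG` of the complex structure on
  `H•(X, ℂ)` and its weight spaces `weightSpace E d = ⊕_{p-q=d} H^{p,q}(X)` (the tree's pointwise types
  `IsOfTypeAt`), **`hodgeDiagonal E = ⊕ₖ H^{k,k}(X)`** (`mem_hodgeDiagonal_iff`); `e_η`, `f_η` commute with the circle
  action for `η` of type `(1,1)` (`lefschetzG_mem_rotCommutant`, `lefschetzDualG_mem_rotCommutant`, through the tree's
  `lefschetzDual_compContinuousLinearMap`), hence **`kaehlerLieAlgebra_le_stabilizer_weightSpace`** and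
  **`kaehlerLieAlgebra_le_stabilizer_hodgeDiagonal`**: `⊕ₖ H^{k,k}(X)` is a `𝔤_K(X)`-submodule of `H•(X, ℂ)`, with the
  restricted representations `hodgeDiagonalRep : 𝔤_K → 𝔤𝔩(⊕ₖ H^{k,k})` and `suHodgeDiagonalRep : 𝔰𝔲(V ⊕ V̄^*) → 𝔤𝔩(⊕ₖ H^{k,k})`.

SCOPE NOTES (faithfulness). (i) `𝔰𝔲(V ⊕ V̄^*)` is written on the real vector space `V ⊕ V^*` as the `𝒥`-linear,
`q`-skew endomorphisms with `Tr_ℝ(𝒥T) = 0`; the docstring of `su` records why this is the special unitary Lie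
algebra of the Hermitian extension of `q` (no complex vector-space structure on `V ⊕ V^*` is built). (ii) (3.4) holds
here for all `g ≥ 1` (for an elliptic curve `𝔰𝔲(1,1) ≅ 𝔰𝔩₂ = 𝔤_K = 𝔤_tot`), whereas (3.3) needed `g ≥ 2`. (iii) The
generators of `𝔤_K` are ALL `L_η`, `η` a real `(1,1)`-form, and the `sl₂`-partners of those with the Lefschetz
property, as in (1.1); that the Kähler (positive) forms already span is not used. (iv) NOT formalised: "a real form
of the case `(A_{2n-1}, A_{n-1} + A_{n-1})`", "`(𝔰𝔲(V ⊕ V̄^*), u)` is a Jordan–Lefschetz pair", and, of the second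
assertion "`⊕ₖ H^{k,k}(X)[n]` is a fundamental Jordan–Lefschetz module of `𝔤_K(X)`" (§2 of the source), everything
beyond "`⊕ₖ H^{k,k}(X)` is a `𝔤_K(X)`-submodule of `H•(X, ℂ)`" (§10: irreducibility and the lowest weight are not
formalised); no `ℚ`-structure is discussed (the source's `𝔤_K` is only defined over `ℝ`).

TECHNIQUE NOTE. On `Module.End ℝ (sumDual E)` and `Module.End ℝ (E →L[ℝ] ℝ)` generic subtraction/negation lemmas
do not rewrite syntactically (two instance paths to `Module ℝ (E →L[ℝ] ℝ)`); endomorphism identities are therefore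
proved pointwise (`LinearMap.ext`), and brackets are unfolded by the definitional `lie_apply'`.

## References

* [LooijengaLunts1997] E. Looijenga, V. A. Lunts, *A Lie algebra attached to a projective variety*, Invent. Math.
  129 (1997), 361–412, §1 (1.1), (1.9), §3 (3.1)–(3.4).
* [FultonHarris1991] W. Fulton, J. Harris, *Representation Theory. A First Course*, GTM 129 (1991), §20.1 (20.4)
  (infinitesimal rotations `X_{x ∧ y}`; their trace).
* [McDuffSalamon2017] D. McDuff, D. Salamon, *Introduction to Symplectic Topology*, 3rd ed., OUP (2017), §2.1
  Thm. 2.1.3 (symplectic bases, the standard form).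
* [Lang2002] S. Lang, *Algebra*, 3rd ed., GTM 211 (2002), III §6 (dual basis), XIII §3 (trace), XIII §5
  (bilinear forms and their matrices).
* [Warner1983] F. W. Warner, *Foundations of Differentiable Manifolds and Lie Groups*, GTM 94 (1983), 2.10–2.11
  (the wedge of covectors; the tree's `WedgeOne.lean`).
* [Voisin2002] C. Voisin, *Hodge Theory and Complex Algebraic Geometry I*, Cambridge Stud. Adv. Math. 76 (2002),
  §2.3.1 (the `U(1)`-action and `(p,q)`-types), §6.2.2 Rem. 6.23 (bidegrees of `L`, `Λ`).
-/

noncomputable section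

open Module Function LieModule Complex
open Literature.LinearAlgebra.Alternating
open Literature.LinearAlgebra.Alternating.GForm (extR intC extRₗ intCₗ)

-- The commutator Lie ring of the associative endomorphism algebras (as in the two A1-43 files).
attribute [local instance 100] LieRing.ofAssociativeRing

namespace Literature.Geometry.Kaehler

namespace ComplexTorus

/-! ### §1 The complex structure `𝒥 = (J, -J^*)` of `V ⊕ V^*` -/

section ComplexStructure

variable (E : Type*) [NormedAddCommGroup E] [NormedSpace ℂ E]

/-- **`J`**: multiplication by `i` on `V = H₁(X; ℝ) = E`, as a real-linear map ("if `J : V → V`,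
`J² = -1_V`, is the complex structure determined by the one of `X`"). [cite: LooijengaLunts1997, §3 (3.4)] -/
def cxJ : E →ₗ[ℝ] E where
  toFun x := (I : ℂ) • x
  map_add' x y := smul_add I x y
  map_smul' c x := smul_comm I c x

/-- unfolding of `cxJ` (definitional). [cite: LooijengaLunts1997, §3 (3.4)] -/
@[simp]
theorem cxJ_apply (x : E) : cxJ E x = I • x := rfl

/-- `J² = -1`. [cite: LooijengaLunts1997, §3 (3.4)] -/
theorem cxJ_cxJ (x : E) : cxJ E (cxJ E x) = -x := by
  rw [cxJ_apply, cxJ_apply, smul_smul, I_mul_I, neg_one_smul]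

/-- `J` as a continuous linear map. [cite: LooijengaLunts1997, §3 (3.4)] -/
def cxJL : E →L[ℝ] E := ⟨cxJ E, continuous_const_smul I⟩

/-- unfolding of `cxJL` (definitional). [cite: LooijengaLunts1997, §3 (3.4)] -/
@[simp]
theorem cxJL_apply (x : E) : cxJL E x = I • x := rfl

/-- **`J^*`**: the transpose complex structure of `V^*`, `(J^* ξ)(x) = ξ(J x)` ("`V^*` … the `ℝ`-dual of `V`
equipped with the complex structure `J^*`"). [cite: LooijengaLunts1997, §3 (3.4)] -/
def cxJt : Module.End ℝ (E →L[ℝ] ℝ) where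
  toFun ξ := ξ.comp (cxJL E)
  map_add' _ _ := ContinuousLinearMap.add_comp _ _ _
  map_smul' _ _ := ContinuousLinearMap.smul_comp _ _ _

/-- unfolding of `cxJt` (definitional). [cite: LooijengaLunts1997, §3 (3.4)] -/
@[simp]
theorem cxJt_apply (ξ : E →L[ℝ] ℝ) (x : E) : cxJt E ξ x = ξ (I • x) := rfl

/-- `(J^*)² = -1`. [cite: LooijengaLunts1997, §3 (3.4)] -/
theorem cxJt_cxJt (ξ : E →L[ℝ] ℝ) : cxJt E (cxJt E ξ) = -ξ := by
  ext x
  simp only [cxJt_apply, smul_smul, I_mul_I, neg_one_smul, map_neg, _root_.neg_apply]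

/-- **The complex structure `𝒥 := (J, -J^*)` of `V ⊕ V̄^*`** ("`V̄^*` denote[s] the `ℝ`-dual of `V` equipped
with the complex structure … `-J^*`"; "the complex structure `(J, -J^*)`") on the tree's `sumDual E = V × V^*`.
[cite: LooijengaLunts1997, §3 (3.4)] -/
def cxStr : Module.End ℝ (sumDual E) := (cxJ E).prodMap (-cxJt E)

/-- unfolding of `cxStr` (definitional). [cite: LooijengaLunts1997, §3 (3.4)] -/
@[simp]
theorem cxStr_apply (x : sumDual E) : cxStr E x = (I • x.1, -cxJt E x.2) := rfl

/-- `𝒥² = -1`. [cite: LooijengaLunts1997, §3 (3.4)] -/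
theorem cxStr_mul_cxStr : cxStr E * cxStr E = -1 := by
  refine LinearMap.ext fun x ↦ Prod.ext ?_ ?_
  · simp only [Module.End.mul_apply, cxStr_apply, smul_smul, I_mul_I, neg_one_smul, LinearMap.neg_apply,
      Module.End.one_apply, Prod.fst_neg]
  · simp only [Module.End.mul_apply, cxStr_apply, map_neg, cxJt_cxJt, neg_neg, LinearMap.neg_apply,
      Module.End.one_apply, Prod.snd_neg]

/-- **"The quadratic form `q` defined above is invariant under the complex structure `(J, -J^*)`"**, in
infinitesimal form: `𝒥` is skew for the polar form `S` of `q`, i.e. `𝒥 ∈ 𝔰𝔬(V ⊕ V^*)` (for `𝒥² = -1`,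
invariance `S(𝒥x, 𝒥y) = S(x, y)` and skewness `S(𝒥x, y) = -S(x, 𝒥y)` are the same condition).
[cite: LooijengaLunts1997, §3 (3.4)] -/
theorem cxStr_mem_so : cxStr E ∈ so E := by
  rw [mem_so_iff]
  intro x y
  simp only [cxStr_apply, splitForm_apply, _root_.neg_apply, cxJt_apply]
  ring

/-- `S(𝒥x, 𝒥y) = S(x, y)`: the polar form of `q` is `𝒥`-invariant. [cite: LooijengaLunts1997, §3 (3.4)] -/
theorem splitForm_cxStr_cxStr (x y : sumDual E) : splitForm E (cxStr E x) (cxStr E y) = splitForm E x y := by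
  simp only [cxStr_apply, splitForm_apply, _root_.neg_apply, cxJt_apply, map_neg, smul_smul, I_mul_I, neg_one_smul,
    neg_neg]

end ComplexStructure

/-! ### §2 Traces: `Tr J = Tr J^* = 0` -/

section Traces

variable (E : Type*) [NormedAddCommGroup E] [NormedSpace ℂ E] [FiniteDimensional ℂ E]

/-- `Tr_ℝ J = 0` (in the real basis `(c_k, i c_k)` of a complex basis `(c_k)` the matrix of `J` has zero
diagonal). [cite: Lang2002, XIII §3] -/
theorem trace_cxJ : LinearMap.trace ℝ E (cxJ E) = 0 := by
  classical
  set c := Module.finBasis ℂ E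
  set b := Complex.basisOneI.smulTower c with hb
  rw [LinearMap.trace_eq_matrix_trace ℝ b, Matrix.trace]
  refine Finset.sum_eq_zero ?_
  rintro ⟨i, k⟩ -
  simp only [Matrix.diag_apply, LinearMap.toMatrix_apply, hb, Module.Basis.smulTower_apply, cxJ_apply, smul_smul,
    Module.Basis.smulTower_repr, map_smul, c.repr_self, Finsupp.smul_single, smul_eq_mul, mul_one,
    Finsupp.single_eq_same, Complex.coe_basisOneI_repr, Complex.coe_basisOneI]
  fin_cases i <;> simp

/-- `Tr_ℝ J^* = Tr_ℝ J` (`= 0`). [cite: Lang2002, XIII §3] -/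
theorem trace_cxJt : LinearMap.trace ℝ (E →L[ℝ] ℝ) (cxJt E) = 0 := by
  classical
  set b := Module.finBasis ℝ E
  rw [trace_eq_sum_apply E b]
  simp only [cxJt_apply, coordCLM_apply]
  have h : LinearMap.trace ℝ E (cxJ E) = ∑ i, b.repr (I • b i) i := by
    rw [LinearMap.trace_eq_matrix_trace ℝ b, Matrix.trace]
    exact Finset.sum_congr rfl fun i _ ↦ by rw [Matrix.diag_apply, LinearMap.toMatrix_apply, cxJ_apply]
  rw [← h, trace_cxJ]

end Traces

/-! ### §3 The special unitary Lie algebra `𝔰𝔲(V ⊕ V̄^*)` -/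

section SpecialUnitary

variable (E : Type*) [NormedAddCommGroup E] [NormedSpace ℂ E] [FiniteDimensional ℂ E]

/-- **`𝔰𝔲(V ⊕ V̄^*)`** ("`q` … extends to a Hermitian form on `V ⊕ V̄^*`. Let `𝔰𝔲(V ⊕ V̄^*)` be the Lie
algebra of the corresponding special unitary group"), on the real carrier `V ⊕ V^* = sumDual E`: a real
endomorphism `T` is in the unitary Lie algebra of the Hermitian extension `h` of `q` iff it is `𝒥`-linear
(`T𝒥 = 𝒥T`) and skew for `Re h`, i.e. `T ∈ 𝔰𝔬(q)`; its complex trace is then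
`Tr_ℂ T = ½ Tr_ℝ T - (i/2) Tr_ℝ(𝒥T)`, whose real part vanishes on `𝔰𝔬(q)` (`trace_eq_zero_of_mem_so`), so
the special unitary condition `Tr_ℂ T = 0` is `Tr_ℝ(𝒥 T) = 0`. [cite: LooijengaLunts1997, §3 (3.4)] -/
def su : LieSubalgebra ℝ (Module.End ℝ (sumDual E)) where
  carrier := {T | T ∈ so E ∧ T * cxStr E = cxStr E * T ∧ LinearMap.trace ℝ _ (cxStr E * T) = 0}
  add_mem' {T S} hT hS := by
    refine ⟨(so E).add_mem hT.1 hS.1, ?_, ?_⟩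
    · rw [add_mul, mul_add, hT.2.1, hS.2.1]
    · rw [mul_add, map_add, hT.2.2, hS.2.2, add_zero]
  zero_mem' := ⟨(so E).zero_mem, by rw [zero_mul, mul_zero], by rw [mul_zero, map_zero]⟩
  smul_mem' c {T} hT := by
    refine ⟨(so E).smul_mem c hT.1, ?_, ?_⟩
    · rw [smul_mul_assoc, mul_smul_comm, hT.2.1]
    · rw [mul_smul_comm, map_smul, hT.2.2, smul_zero]
  lie_mem' {T S} hT hS := by
    -- (pointwise computations: generic ring lemmas do not rewrite syntactically on this `Module.End`)
    have hTc : ∀ v, T (cxStr E v) = cxStr E (T v) := fun v ↦ by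
      simpa only [Module.End.mul_apply] using LinearMap.congr_fun hT.2.1 v
    have hSc : ∀ v, S (cxStr E v) = cxStr E (S v) := fun v ↦ by
      simpa only [Module.End.mul_apply] using LinearMap.congr_fun hS.2.1 v
    have h1 : (T * S - S * T) * cxStr E = cxStr E * (T * S - S * T) := LinearMap.ext fun v ↦ by
      simp only [Module.End.mul_apply, LinearMap.sub_apply, map_sub, hTc, hSc]
    have h3 : cxStr E * (T * S - S * T) + S * (cxStr E * T) = (cxStr E * T) * S := LinearMap.ext fun v ↦ by
      simp only [Module.End.mul_apply, LinearMap.sub_apply, LinearMap.add_apply, map_sub, hSc, sub_add_cancel]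
    have h2 : LinearMap.trace ℝ _ (cxStr E * (T * S - S * T)) = 0 := by
      have h4 := congrArg (LinearMap.trace ℝ (sumDual E)) h3
      rw [map_add, LinearMap.trace_mul_comm ℝ (cxStr E * T) S] at h4
      linarith
    refine ⟨(so E).lie_mem hT.1 hS.1, ?_, ?_⟩
    · rw [LieRing.of_associative_ring_bracket]; exact h1
    · rw [LieRing.of_associative_ring_bracket]; exact h2

omit [FiniteDimensional ℂ E] in
/-- Membership in `𝔰𝔲(V ⊕ V̄^*)`. [cite: LooijengaLunts1997, §3 (3.4)] -/
theorem mem_su_iff (T : Module.End ℝ (sumDual E)) :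
    T ∈ su E ↔ T ∈ so E ∧ T * cxStr E = cxStr E * T ∧ LinearMap.trace ℝ _ (cxStr E * T) = 0 := Iff.rfl

omit [FiniteDimensional ℂ E] in
/-- `𝔰𝔲(V ⊕ V̄^*) ⊆ 𝔰𝔬(V ⊕ V^*)`. [cite: LooijengaLunts1997, §3 (3.4)] -/
theorem su_le_so : su E ≤ so E := fun _ hT ↦ hT.1

/-- The trace of an infinitesimal rotation: `Tr X_{x ∧ y} = B(y, x) - B(x, y)` (`= 0` for symmetric `B`).
[cite: FultonHarris1991, §20.1 (20.4)] -/
theorem trace_soElem {K M : Type*} [Field K] [AddCommGroup M] [Module K M] [FiniteDimensional K M]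
    (B : LinearMap.BilinForm K M) (x y : M) : LinearMap.trace K M (soElem B x y) = B y x - B x y := by
  rw [soElem, map_sub, LinearMap.trace_smulRight, LinearMap.trace_smulRight]

/-- The real trace of an element of `𝔰𝔬(V ⊕ V^*)` vanishes (it is half a sum of infinitesimal rotations
`X_{x ∧ y}`, each of trace `S(y, x) - S(x, y) = 0`), so that on `𝔲` the complex trace is `-(i/2) Tr_ℝ(𝒥 T)`.
[cite: FultonHarris1991, §20.1 (20.4)] -/
theorem trace_eq_zero_of_mem_so {T : Module.End ℝ (sumDual E)} (hT : T ∈ so E) :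
    LinearMap.trace ℝ (sumDual E) T = 0 := by
  classical
  have hT' := (mem_so_iff_neg E T).1 hT
  rw [eq_smul_sum_soElem (-splitForm E) (neg_splitForm_nondegenerate E) (neg_splitForm_isSymm E) hT'
    (Module.finBasis ℝ (sumDual E)), map_smul, map_sum]
  refine smul_eq_zero_of_right _ (Finset.sum_eq_zero fun i _ ↦ ?_)
  rw [trace_soElem, (neg_splitForm_isSymm E).eq, sub_self]

/-- **"Since `u ∈ 𝔰𝔲(V ⊕ V̄^*)`"**: the grading element `u = (-1_V, 1_{V^*})` is special unitary
(`Tr_ℝ(𝒥 u) = -Tr J - Tr J^* = 0`). [cite: LooijengaLunts1997, §3 (3.4)] -/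
theorem gradingElement_mem_su : gradingElement E ∈ su E := by
  refine ⟨gradingElement_mem_so E, ?_, ?_⟩
  · refine LinearMap.ext fun x ↦ Prod.ext ?_ ?_ <;> simp
  · have h : cxStr E * gradingElement E + (cxJ E).prodMap (cxJt E) = 0 := by
      refine LinearMap.ext fun x ↦ Prod.ext ?_ ?_ <;> simp
    have h' := congrArg (LinearMap.trace ℝ (sumDual E)) h
    rw [(LinearMap.trace ℝ _).map_add, LinearMap.trace_prodMap', trace_cxJ, trace_cxJt,
      (LinearMap.trace ℝ _).map_zero] at h'
    simpa using h'

/-- `𝔰𝔲(V ⊕ V̄^*)` as a Lie subalgebra of the tree's `so E` (the type on which the spinor representation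
`spinorRep E` is defined). [cite: LooijengaLunts1997, §3 (3.4)] -/
def suSo : LieSubalgebra ℝ (so E) := (su E).comap (so E).incl

omit [FiniteDimensional ℂ E] in
/-- Membership in `suSo`. [cite: LooijengaLunts1997, §3 (3.4)] -/
@[simp]
theorem mem_suSo_iff (T : so E) : T ∈ suSo E ↔ (T : Module.End ℝ (sumDual E)) ∈ su E := Iff.rfl

end SpecialUnitary

/-! ### §4 "A straightforward verification": the degree-`2` elements of the `J^*`-invariant `2`-forms and the
degree-`-2` elements of the `J`-invariant `2`-vectors are exactly `𝔰𝔲₂` and `𝔰𝔲₋₂` -/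

section DegreeTwo

variable {E : Type*} [NormedAddCommGroup E] [NormedSpace ℂ E] [FiniteDimensional ℂ E]

omit [FiniteDimensional ℂ E] in
/-- `κ(x, -y) = -κ(x, y)` for a real `2`-form. [folklore] -/
private theorem twoForm_neg_right (κ : E [⋀^Fin 2]→L[ℝ] ℝ) (x y : E) : κ ![x, -y] = -κ ![x, y] := by
  rw [← neg_one_smul ℝ y, twoForm_smul_right, neg_one_mul]

omit [FiniteDimensional ℂ E] in
/-- `κ(-x, y) = -κ(x, y)` for a real `2`-form. [folklore] -/
private theorem twoForm_neg_left (κ : E [⋀^Fin 2]→L[ℝ] ℝ) (x y : E) : κ ![-x, y] = -κ ![x, y] := by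
  rw [← neg_one_smul ℝ x, twoForm_smul_left, neg_one_mul]

/-- **The flat map `x ↦ κ(x, ·) : V → V^*` of a real `2`-form `κ ∈ ⋀² V^*`** (the "`σ`" of Looijenga–Lunts'
"for any bilinear form `λ : V × V → ℝ` there is a unique `σ ∈ End(V)` …", before the polarisation is used to
identify `V^*` with `V`). [cite: LooijengaLunts1997, §3 (3.4)] -/
def flat (κ : E [⋀^Fin 2]→L[ℝ] ℝ) : E →ₗ[ℝ] (E →L[ℝ] ℝ) :=
  (LinearMap.toContinuousLinearMap : (E →ₗ[ℝ] ℝ) ≃ₗ[ℝ] (E →L[ℝ] ℝ)).toLinearMap ∘ₗ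
    LinearMap.mk₂ ℝ (fun x y ↦ κ ![x, y]) (twoForm_add_left κ)
      (fun c x y ↦ by rw [smul_eq_mul]; exact twoForm_smul_left κ c x y) (twoForm_add_right κ)
      (fun c x y ↦ by rw [smul_eq_mul]; exact twoForm_smul_right κ c x y)

/-- `flat κ x y = κ(x, y)`. [cite: LooijengaLunts1997, §3 (3.4)] -/
@[simp]
theorem flat_apply (κ : E [⋀^Fin 2]→L[ℝ] ℝ) (x y : E) : flat κ x y = κ ![x, y] := rfl

/-- A non-degenerate `2`-form has an injective flat map. [cite: McDuffSalamon2017, §2.1 Thm. 2.1.3] -/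
theorem flat_injective {κ : E [⋀^Fin 2]→L[ℝ] ℝ} (hnd : ∀ v : E, v ≠ 0 → ∃ w : E, κ ![v, w] ≠ 0) :
    Function.Injective (flat κ) := by
  refine (injective_iff_map_eq_zero _).2 fun v hv ↦ ?_
  by_contra h
  obtain ⟨w, hw⟩ := hnd v h
  exact hw (by rw [← flat_apply, hv, _root_.zero_apply])

/-- For a real `(1,1)`-form (`κ(iu, iv) = κ(u, v)`): `κ(iv, ·) = -J^* κ(v, ·)`. [cite: LooijengaLunts1997, §3 (3.4)] -/
theorem flat_I_smul {κ : E [⋀^Fin 2]→L[ℝ] ℝ} (hJ : ∀ u v : E, κ ![I • u, I • v] = κ ![u, v]) (v : E) :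
    flat κ (I • v) = -cxJt E (flat κ v) := by
  ext w
  rw [flat_apply, _root_.neg_apply, cxJt_apply, flat_apply]
  have h := hJ v (-(I • w))
  rw [smul_neg, smul_smul, I_mul_I, neg_one_smul, neg_neg, twoForm_neg_right] at h
  exact h

/-- **The degree-`2` element `ψ₂(κ) : (x, ξ) ↦ (0, κ(x, ·))` of `𝔰𝔬(V ⊕ V^*)` attached to a `2`-form
`κ ∈ ⋀² V^*`** (the linear extension of Looijenga–Lunts' `ψ₂(α ∧ β)`, `psi2_eq_upEnd`).
[cite: LooijengaLunts1997, §3 (3.1), (3.4)] -/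
def upEnd (κ : E [⋀^Fin 2]→L[ℝ] ℝ) : Module.End ℝ (sumDual E) :=
  LinearMap.inr ℝ E (E →L[ℝ] ℝ) ∘ₗ flat κ ∘ₗ LinearMap.fst ℝ E (E →L[ℝ] ℝ)

/-- unfolding of `upEnd` (definitional). [cite: LooijengaLunts1997, §3 (3.1)] -/
@[simp]
theorem upEnd_apply (κ : E [⋀^Fin 2]→L[ℝ] ℝ) (x : sumDual E) : upEnd κ x = (0, flat κ x.1) := rfl

omit [FiniteDimensional ℂ E] in
/-- `(a ∧ b ∧ 1)(p, q) = a(p) b(q) - a(q) b(p)` for real covectors (the tree's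
`wedgeOne_wedgeOne_constOfIsEmpty_apply` with the scalar `1`). [folklore] -/
private theorem wedgePair_apply (α β : E →L[ℝ] ℝ) (p q : E) :
    wedgeOne α (wedgeOne β (ContinuousAlternatingMap.constOfIsEmpty ℝ E (Fin 0) (1 : ℝ))) ![p, q] =
      α p * β q - α q * β p := by
  rw [wedgeOne_wedgeOne_constOfIsEmpty_apply, smul_eq_mul, mul_one]

/-- **`ψ₂(α ∧ β) = ψ₂` of the `2`-form `α ∧ β`** (Looijenga–Lunts' `ψ₂(α ∧ β)(x, ξ) = (0, α(x)β - β(x)α)`).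
[cite: LooijengaLunts1997, §3 (3.1)] -/
theorem psi2_eq_upEnd (α β : E →L[ℝ] ℝ) :
    psi2 E α β = upEnd (wedgeOne α (wedgeOne β (ContinuousAlternatingMap.constOfIsEmpty ℝ E (Fin 0) (1 : ℝ)))) := by
  refine LinearMap.ext fun x ↦ Prod.ext rfl ?_
  ext v
  rw [psi2_apply, upEnd_apply, flat_apply, wedgePair_apply]
  simp only [_root_.sub_apply, _root_.smul_apply, smul_eq_mul]
  ring

/-- `ψ₂(κ) ∈ 𝔰𝔬(V ⊕ V^*)` for every `2`-form `κ`. [cite: LooijengaLunts1997, §3 (3.1)] -/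
theorem upEnd_mem_so (κ : E [⋀^Fin 2]→L[ℝ] ℝ) : upEnd κ ∈ so E := by
  rw [mem_so_iff]
  intro x y
  simp only [upEnd_apply, splitForm_apply, flat_apply, map_zero, add_zero, zero_add]
  rw [twoForm_swap κ y.1 x.1, neg_neg]

/-- **`ψ₂(κ)` commutes with `𝒥` iff `κ` is `J^*`-invariant**, `κ(iu, iv) = κ(u, v)` — "the `J^*`-invariant
elements of `⋀²_ℝ V^*` are precisely the real `(1,1)`-forms" (the tree's `(1,1)` condition,
`IsNSForm.type_one_one`, `isOfTypeAt_one_one_ofRealForm`). [cite: LooijengaLunts1997, §3 (3.4)] -/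
theorem upEnd_comm_iff (κ : E [⋀^Fin 2]→L[ℝ] ℝ) :
    upEnd κ * cxStr E = cxStr E * upEnd κ ↔ ∀ u v : E, κ ![I • u, I • v] = κ ![u, v] := by
  constructor
  · intro h u v
    have h' := congrArg (fun T : Module.End ℝ (sumDual E) ↦ (T (u, 0)).2 (I • v)) h
    simp only [Module.End.mul_apply, upEnd_apply, cxStr_apply, flat_apply, _root_.neg_apply, cxJt_apply,
      smul_smul, I_mul_I, neg_one_smul, twoForm_neg_right, neg_neg] at h'
    exact h'
  · intro h
    refine LinearMap.ext fun x ↦ Prod.ext ?_ ?_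
    · simp
    · simp only [Module.End.mul_apply, upEnd_apply, cxStr_apply]
      exact flat_I_smul h x.1

/-- `Tr_ℝ(𝒥 ψ₂(κ)) = 0` (`𝒥 ψ₂(κ)` is block-nilpotent). [cite: LooijengaLunts1997, §3 (3.4)] -/
theorem trace_cxStr_mul_upEnd (κ : E [⋀^Fin 2]→L[ℝ] ℝ) : LinearMap.trace ℝ (sumDual E) (cxStr E * upEnd κ) = 0 := by
  have h : cxStr E * upEnd κ =
      (LinearMap.inr ℝ E (E →L[ℝ] ℝ) ∘ₗ
          ((LinearMap.snd ℝ E (E →L[ℝ] ℝ) ∘ₗ cxStr E ∘ₗ LinearMap.inr ℝ E (E →L[ℝ] ℝ)) ∘ₗ flat κ)) ∘ₗ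
        LinearMap.fst ℝ E (E →L[ℝ] ℝ) := by
    refine LinearMap.ext fun x ↦ Prod.ext ?_ ?_ <;> simp
  rw [h, LinearMap.trace_comp_comm', ← LinearMap.comp_assoc, LinearMap.fst_comp_inr, LinearMap.zero_comp, map_zero]

/-- **`ψ₂` maps the `J^*`-invariant `2`-forms into `𝔰𝔲(V ⊕ V̄^*)₂`** (onto: the degree-`2` block of any
`T ∈ 𝔰𝔲` is `ψ₂` of a `J^*`-invariant form, `formOfSkew_blkΦ_I_smul` with `eq_blocks`):
`ψ₂(κ) ∈ 𝔰𝔲` iff `κ(iu, iv) = κ(u, v)`. [cite: LooijengaLunts1997, §3 (3.4)] -/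
theorem upEnd_mem_su_iff (κ : E [⋀^Fin 2]→L[ℝ] ℝ) : upEnd κ ∈ su E ↔ ∀ u v : E, κ ![I • u, I • v] = κ ![u, v] :=
  ⟨fun h ↦ (upEnd_comm_iff κ).1 h.2.1, fun h ↦ ⟨upEnd_mem_so κ, (upEnd_comm_iff κ).2 h, trace_cxStr_mul_upEnd κ⟩⟩

/-- **The degree-`-2` element `ψ₋₂(P) : (x, ξ) ↦ (P ξ, 0)` of `𝔤𝔩(V ⊕ V^*)` attached to a map `P : V^* → V`**
(a `2`-vector `∑ a ∧ b ∈ ⋀² V` acts as `ξ ↦ ∑ (ξ(a) b - ξ(b) a)`, `psiNeg2_eq_lowEnd`; these are exactly the skew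
`P`, `ζ(P ξ) = -ξ(P ζ)`). [cite: LooijengaLunts1997, §3 (3.1), (3.4)] -/
def lowEnd (P : (E →L[ℝ] ℝ) →ₗ[ℝ] E) : Module.End ℝ (sumDual E) :=
  LinearMap.inl ℝ E (E →L[ℝ] ℝ) ∘ₗ P ∘ₗ LinearMap.snd ℝ E (E →L[ℝ] ℝ)

omit [FiniteDimensional ℂ E] in
/-- unfolding of `lowEnd` (definitional). [cite: LooijengaLunts1997, §3 (3.1)] -/
@[simp]
theorem lowEnd_apply (P : (E →L[ℝ] ℝ) →ₗ[ℝ] E) (x : sumDual E) : lowEnd P x = (P x.2, 0) := rfl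

omit [FiniteDimensional ℂ E] in
/-- **`ψ₋₂(a ∧ b) = ψ₋₂` of the map `ξ ↦ ξ(a) b - ξ(b) a`.** [cite: LooijengaLunts1997, §3 (3.1)] -/
theorem psiNeg2_eq_lowEnd (a b : E) :
    psiNeg2 E a b = lowEnd ((evalDual E a).smulRight b - (evalDual E b).smulRight a) := rfl

omit [FiniteDimensional ℂ E] in
/-- `ψ₋₂(P) ∈ 𝔰𝔬(V ⊕ V^*)` iff `P` is skew, `ζ(P ξ) = -ξ(P ζ)` (i.e. `P` comes from a `2`-vector).
[cite: LooijengaLunts1997, §3 (3.1)] -/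
theorem lowEnd_mem_so_iff (P : (E →L[ℝ] ℝ) →ₗ[ℝ] E) :
    lowEnd P ∈ so E ↔ ∀ ξ ζ : E →L[ℝ] ℝ, ζ (P ξ) = -ξ (P ζ) := by
  rw [mem_so_iff]
  constructor
  · intro h ξ ζ
    simpa using h (0, ξ) (0, ζ)
  · intro h x y
    simp only [lowEnd_apply, splitForm_apply, _root_.zero_apply, zero_add, add_zero]
    exact h x.2 y.2

omit [FiniteDimensional ℂ E] in
/-- **`ψ₋₂(P)` commutes with `𝒥` iff `P J^* = -J P`**, i.e. iff the `2`-vector of `P` is `J`-invariant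
(`J(a ∧ b) = Ja ∧ Jb` acts as `J ∘ P ∘ J^*`, and `J⁻¹ = -J`): "the `J`-invariants of `⋀²_ℝ V`".
[cite: LooijengaLunts1997, §3 (3.4)] -/
theorem lowEnd_comm_iff (P : (E →L[ℝ] ℝ) →ₗ[ℝ] E) :
    lowEnd P * cxStr E = cxStr E * lowEnd P ↔ ∀ ξ : E →L[ℝ] ℝ, P (cxJt E ξ) = -(I • P ξ) := by
  constructor
  · intro h ξ
    have h' := congrArg (fun T : Module.End ℝ (sumDual E) ↦ (T (0, -ξ)).1) h
    simp only [Module.End.mul_apply, lowEnd_apply, cxStr_apply, map_neg, neg_neg, smul_neg] at h'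
    exact h'
  · intro h
    refine LinearMap.ext fun x ↦ Prod.ext ?_ ?_
    · simp only [Module.End.mul_apply, lowEnd_apply, cxStr_apply, map_neg, h, neg_neg]
    · simp

/-- `Tr_ℝ(𝒥 ψ₋₂(P)) = 0` (`𝒥 ψ₋₂(P)` is block-nilpotent). [cite: LooijengaLunts1997, §3 (3.4)] -/
theorem trace_cxStr_mul_lowEnd (P : (E →L[ℝ] ℝ) →ₗ[ℝ] E) : LinearMap.trace ℝ (sumDual E) (cxStr E * lowEnd P) = 0 := by
  have h : cxStr E * lowEnd P =
      (LinearMap.inl ℝ E (E →L[ℝ] ℝ) ∘ₗ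
          ((LinearMap.fst ℝ E (E →L[ℝ] ℝ) ∘ₗ cxStr E ∘ₗ LinearMap.inl ℝ E (E →L[ℝ] ℝ)) ∘ₗ P)) ∘ₗ
        LinearMap.snd ℝ E (E →L[ℝ] ℝ) := by
    refine LinearMap.ext fun x ↦ Prod.ext ?_ ?_ <;> simp
  rw [h, LinearMap.trace_comp_comm', ← LinearMap.comp_assoc, LinearMap.snd_comp_inl, LinearMap.zero_comp, map_zero]

/-- **`ψ₋₂` maps the `J`-invariant `2`-vectors into `𝔰𝔲(V ⊕ V̄^*)₋₂`** (onto: the degree-`-2` block of any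
`T ∈ 𝔰𝔲` is such a `ψ₋₂(P)`, `blkP_skew`/`blkP_cxJt` with `eq_blocks`): `ψ₋₂(P) ∈ 𝔰𝔲` iff `P` is skew and
`P J^* = -J P`. [cite: LooijengaLunts1997, §3 (3.4)] -/
theorem lowEnd_mem_su_iff (P : (E →L[ℝ] ℝ) →ₗ[ℝ] E) :
    lowEnd P ∈ su E ↔ (∀ ξ ζ : E →L[ℝ] ℝ, ζ (P ξ) = -ξ (P ζ)) ∧ ∀ ξ : E →L[ℝ] ℝ, P (cxJt E ξ) = -(I • P ξ) :=
  ⟨fun h ↦ ⟨(lowEnd_mem_so_iff P).1 h.1, (lowEnd_comm_iff P).1 h.2.1⟩,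
    fun h ↦ ⟨(lowEnd_mem_so_iff P).2 h.1, (lowEnd_comm_iff P).2 h.2, trace_cxStr_mul_lowEnd P⟩⟩

end DegreeTwo

/-! ### §5 Symplectic frames: `e_κ = ρ ψ₂(κ)` and `f_κ = ρ ψ₋₂(κ⁻¹)`, with `κ⁻¹` `J`-invariant when `κ` is -/

section Frames

variable {E : Type*} [NormedAddCommGroup E] [NormedSpace ℂ E] [FiniteDimensional ℂ E] {n : ℕ}

omit [FiniteDimensional ℂ E] in
/-- Two real `2`-forms agreeing on all pairs of vectors of a real basis are equal
(`Module.Basis.ext_multilinear`). [cite: Lang2002, III §6] -/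
theorem twoForm_ext_of_basis {ι' : Type*} (b : Module.Basis ι' ℝ E) {F : Type*} [NormedAddCommGroup F]
    [NormedSpace ℝ F] {κ κ' : E [⋀^Fin 2]→L[ℝ] F} (h : ∀ p q : ι', κ ![b p, b q] = κ' ![b p, b q]) : κ = κ' := by
  have key : κ.toContinuousMultilinearMap.toMultilinearMap = κ'.toContinuousMultilinearMap.toMultilinearMap :=
    Module.Basis.ext_multilinear (fun _ ↦ b) fun v ↦ by
      have e : (fun m ↦ b (v m)) = ![b (v 0), b (v 1)] := by
        funext m; fin_cases m <;> rfl
      change κ (fun m ↦ b (v m)) = κ' (fun m ↦ b (v m))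
      rw [e]
      exact h (v 0) (v 1)
  ext v
  exact congrArg (fun f : MultilinearMap ℝ (fun _ : Fin 2 ↦ E) F ↦ f v) key

/-- **A `2`-form with a symplectic frame is the standard form of the frame**: `κ = ∑ᵢ eᵢ^* ∧ fᵢ^*`
("`κ = ∑_{k=1}^n α_k ∧ α_{-k}`"). [cite: LooijengaLunts1997, §3 proof of (3.3)] -/
theorem IsSymplecticBasis.eq_frameForm {κ : E [⋀^Fin 2]→L[ℝ] ℝ} {b : Module.Basis (Fin n ⊕ Fin n) ℝ E}
    (hb : IsSymplecticBasis κ b) : κ = frameForm b := by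
  have hb' := isSymplecticBasis_frameForm b
  refine twoForm_ext_of_basis b fun p q ↦ ?_
  rcases p with i | i <;> rcases q with j | j
  · rw [hb.inl_inl, hb'.inl_inl]
  · rw [hb.inl_inr, hb'.inl_inr]
  · rw [twoForm_swap κ, twoForm_swap (frameForm b), hb.inl_inr, hb'.inl_inr]
  · rw [hb.inr_inr, hb'.inr_inr]

/-- **`∑ᵢ ψ₂(eᵢ^* ∧ fᵢ^*) = ψ₂(κ_b)`** for the standard form `κ_b = ∑ᵢ eᵢ^* ∧ fᵢ^*` of a split frame.
[cite: LooijengaLunts1997, §3 proof of (3.3)] -/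
theorem sum_psi2_eq_upEnd_frameForm (b : Module.Basis (Fin n ⊕ Fin n) ℝ E) :
    ∑ i : Fin n, psi2 E ((b.coord (Sum.inl i)).toContinuousLinearMap) ((b.coord (Sum.inr i)).toContinuousLinearMap) =
      upEnd (frameForm b) := by
  refine LinearMap.ext fun x ↦ Prod.ext ?_ ?_
  · rw [LinearMap.coe_sum, Finset.sum_apply, Prod.fst_sum, upEnd_apply]
    simp
  · rw [LinearMap.coe_sum, Finset.sum_apply, Prod.snd_sum, upEnd_apply]
    ext v
    rw [_root_.sum_apply, flat_apply, frameForm_apply]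
    refine Finset.sum_congr rfl fun i _ ↦ ?_
    simp only [psi2_apply, _root_.sub_apply, _root_.smul_apply, smul_eq_mul]
    ring

/-- **The sharp map `κ_b⁻¹ : V^* → V` of a split frame**, `ξ ↦ ∑ᵢ (ξ(fᵢ) eᵢ - ξ(eᵢ) fᵢ)` — the `2`-vector
`∑ᵢ fᵢ ∧ eᵢ` ("if `a_{±1}, …, a_{±n}` is the dual basis … `∑ i_{a_{-k}} i_{a_k}`"), inverse to the flat map of
`κ_b` (`IsSymplecticBasis.flat_frameSharp`). [cite: LooijengaLunts1997, §3 proof of (3.3)] -/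
def frameSharp (b : Module.Basis (Fin n ⊕ Fin n) ℝ E) : (E →L[ℝ] ℝ) →ₗ[ℝ] E :=
  ∑ i : Fin n, ((evalDual E (b (Sum.inr i))).smulRight (b (Sum.inl i)) -
    (evalDual E (b (Sum.inl i))).smulRight (b (Sum.inr i)))

omit [FiniteDimensional ℂ E] in
/-- `κ_b⁻¹ ξ = ∑ᵢ (ξ(fᵢ) eᵢ - ξ(eᵢ) fᵢ)`. [cite: LooijengaLunts1997, §3 proof of (3.3)] -/
theorem frameSharp_apply (b : Module.Basis (Fin n ⊕ Fin n) ℝ E) (ξ : E →L[ℝ] ℝ) :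
    frameSharp b ξ = ∑ i : Fin n, (ξ (b (Sum.inr i)) • b (Sum.inl i) - ξ (b (Sum.inl i)) • b (Sum.inr i)) := by
  simp [frameSharp, LinearMap.sum_apply]

omit [FiniteDimensional ℂ E] in
/-- **`∑ᵢ ψ₋₂(fᵢ ∧ eᵢ) = ψ₋₂(κ_b⁻¹)`.** [cite: LooijengaLunts1997, §3 proof of (3.3)] -/
theorem sum_psiNeg2_eq_lowEnd_frameSharp (b : Module.Basis (Fin n ⊕ Fin n) ℝ E) :
    ∑ i : Fin n, psiNeg2 E (b (Sum.inr i)) (b (Sum.inl i)) = lowEnd (frameSharp b) := by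
  refine LinearMap.ext fun x ↦ Prod.ext ?_ ?_
  · rw [LinearMap.coe_sum, Finset.sum_apply, Prod.fst_sum, lowEnd_apply, frameSharp_apply]
    simp
  · rw [LinearMap.coe_sum, Finset.sum_apply, Prod.snd_sum, lowEnd_apply]
    simp

/-- **`κ(κ_b⁻¹ ξ, ·) = ξ`**: in a symplectic frame of `κ` the sharp map of the frame inverts the flat map of `κ`.
[cite: LooijengaLunts1997, §3 proof of (3.3)] -/
theorem IsSymplecticBasis.flat_frameSharp {κ : E [⋀^Fin 2]→L[ℝ] ℝ} {b : Module.Basis (Fin n ⊕ Fin n) ℝ E}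
    (hb : IsSymplecticBasis κ b) (ξ : E →L[ℝ] ℝ) : flat κ (frameSharp b ξ) = ξ := by
  have hvu : ∀ i j, κ ![b (Sum.inr i), b (Sum.inl j)] = -(if j = i then 1 else 0) := fun i j ↦ by
    rw [twoForm_swap κ, hb.inl_inr]
  refine ContinuousLinearMap.coe_inj.1 (b.ext fun p ↦ ?_)
  rw [ContinuousLinearMap.coe_coe, ContinuousLinearMap.coe_coe, frameSharp_apply, map_sum, _root_.sum_apply]
  simp only [map_sub, map_smul, _root_.sub_apply, _root_.smul_apply, flat_apply, smul_eq_mul]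
  rcases p with k | k
  · simp only [hb.inl_inl, hvu, mul_zero, mul_neg, zero_sub, neg_neg, mul_ite, mul_one]
    rw [Finset.sum_ite_eq Finset.univ k]
    simp
  · simp only [hb.inl_inr, hb.inr_inr, mul_ite, mul_one, mul_zero, sub_zero]
    rw [Finset.sum_ite_eq' Finset.univ k]
    simp

/-- **For a `J`-invariant `κ` with symplectic frame `b`, `ψ₋₂(κ_b⁻¹) ∈ 𝔰𝔲(V ⊕ V̄^*)`** (the `2`-vector `κ⁻¹`
is `J`-invariant: `κ(J κ⁻¹ξ, y) = -κ(κ⁻¹ξ, Jy) = -ξ(Jy) = κ(κ⁻¹(-J^*ξ), y)` and `κ` is non-degenerate).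
[cite: LooijengaLunts1997, §3 (3.4)] -/
theorem IsSymplecticBasis.lowEnd_frameSharp_mem_su {κ : E [⋀^Fin 2]→L[ℝ] ℝ} {b : Module.Basis (Fin n ⊕ Fin n) ℝ E}
    (hb : IsSymplecticBasis κ b) (hJ : ∀ u v : E, κ ![I • u, I • v] = κ ![u, v]) :
    lowEnd (frameSharp b) ∈ su E := by
  rw [lowEnd_mem_su_iff]
  refine ⟨fun ξ ζ ↦ ?_, fun ξ ↦ flat_injective hb.nondegenerate ?_⟩
  · have h1 : ζ (frameSharp b ξ) = κ ![frameSharp b ζ, frameSharp b ξ] := by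
      rw [← flat_apply, hb.flat_frameSharp]
    have h2 : ξ (frameSharp b ζ) = κ ![frameSharp b ξ, frameSharp b ζ] := by
      rw [← flat_apply, hb.flat_frameSharp]
    rw [h1, h2, twoForm_swap κ]
  · rw [hb.flat_frameSharp, map_neg, flat_I_smul hJ, neg_neg, hb.flat_frameSharp]

end Frames

/-! ### §6 `e_κ = ρ(ψ₂(κ))` for EVERY real `2`-form `κ` (a frame expansion `κ = ½ ∑ᵢ bᵢ^* ∧ κ(bᵢ, ·)`) -/

section HalfSum

variable {E : Type*} [NormedAddCommGroup E] [NormedSpace ℂ E] [FiniteDimensional ℂ E]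
  {ι' : Type*} [Fintype ι'] [DecidableEq ι'] (b : Module.Basis ι' ℝ E) (κ : E [⋀^Fin 2]→L[ℝ] ℝ)

omit [DecidableEq ι'] in
/-- `∑ᵢ bᵢ^*(x) κ(bᵢ, y) = κ(x, y)` (expand `x` in the basis). [folklore] -/
private theorem sum_coord_mul_apply (x y : E) : ∑ i, coordCLM E b i x * κ ![b i, y] = κ ![x, y] := by
  have h := congrArg (fun v ↦ flat κ v y) (sum_coordCLM_smul E b x)
  simpa only [map_sum, map_smul, _root_.sum_apply, _root_.smul_apply, flat_apply, smul_eq_mul] using h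

omit [DecidableEq ι'] in
/-- **`ψ₂(κ) = ½ ∑ᵢ ψ₂(bᵢ^* ∧ κ(bᵢ, ·))`** in any real basis `(bᵢ)` with coframe `(bᵢ^*)` (since
`κ = ½ ∑ᵢ bᵢ^* ∧ κ(bᵢ, ·)`). [cite: LooijengaLunts1997, §3 (3.1)] -/
theorem upEnd_eq_half_sum_psi2 : upEnd κ = (1 / 2 : ℝ) • ∑ i, psi2 E (coordCLM E b i) (flat κ (b i)) := by
  refine LinearMap.ext fun x ↦ Prod.ext ?_ ?_
  · rw [upEnd_apply, LinearMap.smul_apply, LinearMap.coe_sum, Finset.sum_apply, Prod.smul_fst, Prod.fst_sum]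
    simp
  · rw [upEnd_apply, LinearMap.smul_apply, LinearMap.coe_sum, Finset.sum_apply, Prod.smul_snd, Prod.snd_sum]
    ext y
    rw [_root_.smul_apply, _root_.sum_apply, flat_apply]
    simp only [psi2_apply, _root_.sub_apply, _root_.smul_apply, flat_apply, smul_eq_mul, Finset.sum_sub_distrib]
    have h2 : ∑ i, κ ![b i, x.1] * coordCLM E b i y = κ ![y, x.1] := by
      simpa only [mul_comm] using sum_coord_mul_apply b κ y x.1
    rw [sum_coord_mul_apply b κ, h2, twoForm_swap κ y x.1]
    ring

/-- **`κ = ½ ∑ᵢ bᵢ^* ∧ κ(bᵢ, ·)`** as a complex-valued `2`-form (the tree's `ofRealForm κ`), in any real basis.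
[cite: LooijengaLunts1997, §3 (3.1)] -/
theorem ofRealForm_eq_half_sum :
    ofRealForm κ = (1 / 2 : ℝ) • ∑ i, wedgeOne (coordCLM E b i)
      (wedgeOne (flat κ (b i)) (ContinuousAlternatingMap.constOfIsEmpty ℝ E (Fin 0) (1 : ℂ))) := by
  refine twoForm_ext_of_basis b fun p q ↦ ?_
  rw [ofRealForm_apply, ContinuousAlternatingMap.smul_apply, ContinuousAlternatingMap.sum_apply]
  simp only [wedgeOne_wedgeOne_constOfIsEmpty_apply, coordCLM_apply_basis, flat_apply, ite_mul, one_mul, zero_mul,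
    ← Finset.sum_smul, Finset.sum_sub_distrib, Finset.sum_ite_eq, Finset.mem_univ, if_true]
  rw [twoForm_swap κ (b q) (b p), sub_neg_eq_add, smul_smul, Complex.real_smul, mul_one]
  push_cast
  ring

/-- `κ ∧ χ = ½ ∑ᵢ bᵢ^* ∧ κ(bᵢ, ·) ∧ χ` (reindexed along `2 + m = m + 2`). [cite: LooijengaLunts1997, §3 (3.1)] -/
theorem ofRealForm_wedge_eq_half_sum {m : ℕ} (χ : E [⋀^Fin m]→L[ℝ] ℂ) :
    ((ofRealForm κ).wedge χ).domDomCongr (finCongr (Nat.add_comm 2 m)) =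
      (1 / 2 : ℝ) • ∑ i, wedgeOne (coordCLM E b i) (wedgeOne (flat κ (b i)) χ) := by
  rw [ofRealForm_eq_half_sum b κ, ContinuousAlternatingMap.wedge_smul_left, ContinuousAlternatingMap.domDomCongr_smul,
    sum_wedge_left, domDomCongr_sum]
  congr 1
  refine Finset.sum_congr rfl fun i _ ↦ ?_
  rw [wedgeOne_wedge_eq, wedgeOne_wedge_eq, ContinuousAlternatingMap.constOfIsEmpty_one_wedge]
  simp only [wedgeOne_domDomCongr_finCongr, domDomCongr_finCongr_trans]
  exact domDomCongr_finCongr_self _ _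

/-- **The Lefschetz operator of ANY real `2`-form in CAR form**: `L_κ χ = ½ ∑ᵢ bᵢ^* ∧ κ(bᵢ, ·) ∧ χ` (the tree's
`IsSymplecticBasis.lefschetzPow_one_eq_sum` needs a symplectic frame, hence `κ` non-degenerate).
[cite: LooijengaLunts1997, §3 (3.1)] -/
theorem lefschetzPow_one_eq_half_sum {m : ℕ} (h : 2 * 1 + m = m + 2) (χ : E [⋀^Fin m]→L[ℝ] ℂ) :
    lefschetzPow κ 1 h χ = (1 / 2 : ℝ) • ∑ i, wedgeOne (coordCLM E b i) (wedgeOne (flat κ (b i)) χ) := by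
  have h0 : (wedgePow (ofRealForm κ) 0).wedge χ = χ.domDomCongr (finCongr (Nat.zero_add m).symm) := by
    rw [wedgePow_zero]
    exact ContinuousAlternatingMap.constOfIsEmpty_one_wedge χ
  rw [← ofRealForm_wedge_eq_half_sum b κ χ, lefschetzPow_apply, wedgePow_succ_eq_wedge_left,
    domDomCongr_finCongr_wedge, ContinuousAlternatingMap.WedgeAssoc_holds ℝ E ℂ, h0, wedge_domDomCongr_finCongr]
  simp only [domDomCongr_finCongr_trans]

/-- **`e_κ = ½ ∑ᵢ e_{bᵢ^*} e_{κ(bᵢ, ·)}`** on `⊕ₖ ⋀ᵏ V^* ⊗ ℂ`, for every real `2`-form `κ` and every real basis.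
[cite: LooijengaLunts1997, §3 (3.1)] -/
theorem lefschetzG_eq_half_sum : lefschetzG κ = (1 / 2 : ℝ) • ∑ i, extR (coordCLM E b i) * extR (flat κ (b i)) := by
  refine LinearMap.ext fun w ↦ funext fun m ↦ ?_
  rw [LinearMap.smul_apply, LinearMap.coe_sum, Finset.sum_apply, Pi.smul_apply, Finset.sum_apply]
  match m with
  | 0 => simp only [lefschetzG_apply_zero, Module.End.mul_apply, GForm.extR_apply_zero, Finset.sum_const_zero, smul_zero]
  | 1 =>
    simp only [lefschetzG_apply_one, Module.End.mul_apply, GForm.extR_apply_succ, GForm.extR_apply_zero, wedgeOne_zero,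
      Finset.sum_const_zero, smul_zero]
  | m + 2 =>
    rw [lefschetzG_apply_add_two, lefschetzPow_one_eq_half_sum b κ]
    congr 1
    exact Finset.sum_congr rfl fun i _ ↦ by rw [Module.End.mul_apply, GForm.extR_apply_succ, GForm.extR_apply_succ]

omit [DecidableEq ι'] in
/-- **`ρ(ψ₂(κ)) = e_κ`**: the spinor representation maps the degree-`2` element of a real `2`-form `κ` to its
Lefschetz operator `L_κ = κ ∧ ·` on `H•(X, ℂ)` — for EVERY `κ`, degenerate or not.
[cite: LooijengaLunts1997, §3 (3.2), (3.4)] -/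
theorem spinorRepLin_upEnd : spinorRepLin E (upEnd κ) = lefschetzG κ := by
  classical
  rw [upEnd_eq_half_sum_psi2 (Module.finBasis ℝ E) κ, map_smul, map_sum, lefschetzG_eq_half_sum (Module.finBasis ℝ E) κ]
  exact congrArg _ (Finset.sum_congr rfl fun i _ ↦ spinorRepLin_psi2 E _ _)

end HalfSum

section FormOfSkew

variable {E : Type*} [NormedAddCommGroup E] [NormedSpace ℂ E] [FiniteDimensional ℂ E]

/-- **The `2`-form of a skew map `Φ : V → V^*`**, `½ ∑ᵢ bᵢ^* ∧ Φ(bᵢ)` in the reference real basis of `E`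
(its flat map is `Φ` again, `flat_formOfSkew`). [folklore] -/
def formOfSkew (Φ : E →ₗ[ℝ] (E →L[ℝ] ℝ)) : E [⋀^Fin 2]→L[ℝ] ℝ :=
  (1 / 2 : ℝ) • ∑ i, wedgeOne (coordCLM E (Module.finBasis ℝ E) i)
    (wedgeOne (Φ (Module.finBasis ℝ E i)) (ContinuousAlternatingMap.constOfIsEmpty ℝ E (Fin 0) (1 : ℝ)))

/-- `formOfSkew Φ (x, y) = Φ x y` for a skew `Φ`. [cite: Lang2002, XIII §5] -/
theorem formOfSkew_apply {Φ : E →ₗ[ℝ] (E →L[ℝ] ℝ)} (hΦ : ∀ x y : E, Φ x y = -Φ y x) (x y : E) :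
    formOfSkew Φ ![x, y] = Φ x y := by
  classical
  set b := Module.finBasis ℝ E
  rw [formOfSkew, ContinuousAlternatingMap.smul_apply, ContinuousAlternatingMap.sum_apply]
  simp only [wedgePair_apply]
  have h1 : ∑ i, coordCLM E b i x * Φ (b i) y = Φ x y := by
    have h := congrArg (fun v ↦ Φ v y) (sum_coordCLM_smul E b x)
    simpa only [map_sum, map_smul, _root_.sum_apply, _root_.smul_apply, smul_eq_mul] using h
  have h2 : ∑ i, coordCLM E b i y * Φ (b i) x = Φ y x := by
    have h := congrArg (fun v ↦ Φ v x) (sum_coordCLM_smul E b y)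
    simpa only [map_sum, map_smul, _root_.sum_apply, _root_.smul_apply, smul_eq_mul] using h
  rw [Finset.sum_sub_distrib, h1, h2, hΦ y x, smul_eq_mul]
  ring

/-- `(formOfSkew Φ)♭ = Φ` for a skew `Φ`. [cite: Lang2002, XIII §5] -/
theorem flat_formOfSkew {Φ : E →ₗ[ℝ] (E →L[ℝ] ℝ)} (hΦ : ∀ x y : E, Φ x y = -Φ y x) : flat (formOfSkew Φ) = Φ :=
  LinearMap.ext fun x ↦ ContinuousLinearMap.ext fun y ↦ by rw [flat_apply, formOfSkew_apply hΦ]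

/-- `formOfSkew Φ` is `J`-invariant when `Φ(Jv) = -J^* Φ(v)`. [cite: LooijengaLunts1997, §3 (3.4)] -/
theorem formOfSkew_I_smul {Φ : E →ₗ[ℝ] (E →L[ℝ] ℝ)} (hΦ : ∀ x y : E, Φ x y = -Φ y x)
    (hΦJ : ∀ v : E, Φ (I • v) = -cxJt E (Φ v)) (u v : E) : formOfSkew Φ ![I • u, I • v] = formOfSkew Φ ![u, v] := by
  rw [formOfSkew_apply hΦ, formOfSkew_apply hΦ, hΦJ, _root_.neg_apply, cxJt_apply, smul_smul, I_mul_I, neg_one_smul,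
    map_neg, neg_neg]

end FormOfSkew


/-! ### §7 The Kähler Lie algebra `𝔤_K(X; ℝ)` and `𝔤_K ⊆ ρ(𝔰𝔲(V ⊕ V̄^*))` -/

section Kaehler

variable (E : Type*) [NormedAddCommGroup E] [NormedSpace ℂ E]

/-- **The Kähler Lie algebra `𝔤_K(X; ℝ)` of the complex torus `X = E/Λ`** (Looijenga–Lunts (1.1) and (1.9): "If
we want to take the complex structure into account, then it is more natural to regard `H(X)[n]` as module over
`H^{1,1}(X)` … We shall refer to the associated Lie algebra as the Kähler Lie algebra of `X` and denote it by
`𝔤_K(X)`", where "`𝔤(𝔞, M)` denote[s] the Lie subalgebra of `𝔤𝔩(M)` generated by the transformations `e_a, f_a`",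
`f_a` defined for the `a` with the Lefschetz property): the real Lie subalgebra of `𝔤𝔩(H•(X, ℂ))`,
`H•(X, ℂ) = ⊕ₖ Alt^k_ℝ(E; ℂ) = GForm E ℂ`, generated by the Lefschetz operators `e_η = L_η` of the real
`(1,1)`-classes `η ∈ H^{1,1}(X) ∩ H²(X; ℝ)` — the real `2`-forms with `η(iu, iv) = η(u, v)` ("the `J^*`-invariant
elements of `⋀²_ℝ V^*` are precisely the real `(1,1)`-forms") — and their partners `f_η = Λ` over all
`sl₂`-triples `(L_η, h, Λ)`, `h = countingG E` (cf. the tree's `totalLieAlgebra E` for `𝔞 = H²(X; ℝ)`).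
[cite: LooijengaLunts1997, §1 (1.1) and (1.9), §3 (3.4)] -/
def kaehlerLieAlgebra : LieSubalgebra ℝ (Module.End ℂ (GForm E ℂ)) :=
  LieSubalgebra.lieSpan ℝ (Module.End ℂ (GForm E ℂ))
    {T | ∃ η : E [⋀^Fin 2]→L[ℝ] ℝ, (∀ u v : E, η ![I • u, I • v] = η ![u, v]) ∧
      (T = lefschetzG η ∨ IsSl2Triple (countingG E) (lefschetzG η) T)}

variable {E} {η : E [⋀^Fin 2]→L[ℝ] ℝ} {Λ : Module.End ℂ (GForm E ℂ)}

/-- `e_η ∈ 𝔤_K` for every real `(1,1)`-form `η`. [cite: LooijengaLunts1997, §1 (1.1)] -/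
theorem lefschetzG_mem_kaehlerLieAlgebra (hη : ∀ u v : E, η ![I • u, I • v] = η ![u, v]) :
    lefschetzG η ∈ kaehlerLieAlgebra E :=
  LieSubalgebra.subset_lieSpan ⟨η, hη, Or.inl rfl⟩

/-- `f_η ∈ 𝔤_K` for a real `(1,1)`-form `η` with the Lefschetz property. [cite: LooijengaLunts1997, §1 (1.1)] -/
theorem mem_kaehlerLieAlgebra_of_isSl2Triple (hη : ∀ u v : E, η ![I • u, I • v] = η ![u, v])
    (t : IsSl2Triple (countingG E) (lefschetzG η) Λ) : Λ ∈ kaehlerLieAlgebra E :=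
  LieSubalgebra.subset_lieSpan ⟨η, hη, Or.inr t⟩

/-- `h = [e_η, f_η] ∈ 𝔤_K`. [cite: LooijengaLunts1997, §1 (1.1)] -/
theorem countingG_mem_kaehlerLieAlgebra (hη : ∀ u v : E, η ![I • u, I • v] = η ![u, v])
    (t : IsSl2Triple (countingG E) (lefschetzG η) Λ) : countingG E ∈ kaehlerLieAlgebra E := by
  rw [← t.lie_e_f]
  exact LieSubalgebra.lie_mem _ (lefschetzG_mem_kaehlerLieAlgebra hη) (mem_kaehlerLieAlgebra_of_isSl2Triple hη t)

variable [FiniteDimensional ℂ E]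

/-- `Λ_η ∈ 𝔤_K` for a non-degenerate real `(1,1)`-form `η` (the tree's dual Lefschetz operator).
[cite: LooijengaLunts1997, §1 (1.1)] -/
theorem lefschetzDualG_mem_kaehlerLieAlgebra [Nontrivial E] (hη : ∀ u v : E, η ![I • u, I • v] = η ![u, v])
    (hnd : ∀ v : E, v ≠ 0 → ∃ w : E, η ![v, w] ≠ 0) : lefschetzDualG η ∈ kaehlerLieAlgebra E :=
  mem_kaehlerLieAlgebra_of_isSl2Triple hη (isSl2Triple hnd)

/-- `e_κ ∈ 𝔤 = lieSpan {e_α e_β, i_a i_b}` for EVERY real `2`-form `κ` (`e_κ = ½ ∑ᵢ e_{bᵢ^*} e_{κ(bᵢ, ·)}`).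
[cite: LooijengaLunts1997, §3 (3.1)] -/
theorem lefschetzG_mem_spinorAlgebra' (κ : E [⋀^Fin 2]→L[ℝ] ℝ) : lefschetzG κ ∈ spinorAlgebra E := by
  classical
  rw [lefschetzG_eq_half_sum (Module.finBasis ℝ E) κ]
  exact (spinorAlgebra E).smul_mem _ (sum_mem fun i _ ↦ extR_mul_extR_mem E _ _)

/-- **`𝔤_K(X; ℝ) ⊆ 𝔤_tot(X; ℝ)`** (`g ≥ 1`). [cite: LooijengaLunts1997, §1 (1.9)] -/
theorem kaehlerLieAlgebra_le_totalLieAlgebra [Nontrivial E] : kaehlerLieAlgebra E ≤ totalLieAlgebra E := by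
  rw [kaehlerLieAlgebra, LieSubalgebra.lieSpan_le]
  rintro T ⟨η, -, rfl | t⟩
  · rw [totalLieAlgebra_eq_spinorAlgebra]
    exact lefschetzG_mem_spinorAlgebra' η
  · exact mem_totalLieAlgebra_of_isSl2Triple t

variable (E) in
/-- **The restriction `ρ|_{𝔰𝔲}` of the spinor representation to `𝔰𝔲(V ⊕ V̄^*) ⊆ 𝔰𝔬(V ⊕ V^*)`.**
[cite: LooijengaLunts1997, §3 (3.4)] -/
def suRep : suSo E →ₗ⁅ℝ⁆ Module.End ℂ (GForm E ℂ) := (spinorRep E).comp (suSo E).incl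

omit [FiniteDimensional ℂ E] in
/-- unfolding of `suRep` (definitional). [cite: LooijengaLunts1997, §3 (3.4)] -/
@[simp]
theorem suRep_apply [FiniteDimensional ℂ E] (T : suSo E) :
    suRep E T = spinorRepLin E (T : so E) := rfl

/-- `ρ|_{𝔰𝔲}` is injective. [cite: LooijengaLunts1997, §3 (3.2)] -/
theorem suRep_injective : Function.Injective (suRep E) :=
  (spinorRep_injective E).comp Subtype.val_injective

/-- Membership in the range of `ρ|_{𝔰𝔲}`: the images of the elements of `𝔰𝔲(V ⊕ V̄^*)`.
[cite: LooijengaLunts1997, §3 (3.4)] -/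
theorem mem_range_suRep_iff {S : Module.End ℂ (GForm E ℂ)} :
    S ∈ (suRep E).range ↔ ∃ T ∈ su E, spinorRepLin E T = S := by
  rw [LieHom.mem_range]
  constructor
  · rintro ⟨T, rfl⟩
    exact ⟨(T : so E), T.2, rfl⟩
  · rintro ⟨T, hT, rfl⟩
    exact ⟨⟨⟨T, su_le_so E hT⟩, hT⟩, rfl⟩

/-- `ρ(T) ∈ ρ(𝔰𝔲)` for `T ∈ 𝔰𝔲`. [cite: LooijengaLunts1997, §3 (3.4)] -/
theorem spinorRepLin_mem_range_suRep {T : Module.End ℝ (sumDual E)} (hT : T ∈ su E) :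
    spinorRepLin E T ∈ (suRep E).range :=
  mem_range_suRep_iff.2 ⟨T, hT, rfl⟩

/-- **`𝔤_K(X; ℝ) ⊆ ρ(𝔰𝔲(V ⊕ V̄^*))`** (`g ≥ 1`): `e_η = ρ ψ₂(η)` with `ψ₂(η) ∈ 𝔰𝔲` for a real `(1,1)`-form `η`,
and an `sl₂`-partner of `e_η` is `f_η = ∑ i_{a_{-k}} i_{a_k} = ρ ψ₋₂(η⁻¹)` in a symplectic frame, with `η⁻¹`
`J`-invariant. [cite: LooijengaLunts1997, §3 (3.4)] -/
theorem kaehlerLieAlgebra_le_range [Nontrivial E] : kaehlerLieAlgebra E ≤ (suRep E).range := by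
  rw [kaehlerLieAlgebra, LieSubalgebra.lieSpan_le]
  rintro T ⟨η, hη, rfl | t⟩
  · rw [SetLike.mem_coe, ← spinorRepLin_upEnd η]
    exact spinorRepLin_mem_range_suRep ((upEnd_mem_su_iff η).2 hη)
  · have hnd := nondegenerate_of_isSl2Triple t
    obtain ⟨b, hb⟩ := exists_isSymplecticBasis hnd
    rw [SetLike.mem_coe, eq_lefschetzDualG_of_isSl2Triple t, hb.lefschetzDualG_eq_sum_intC_mul]
    have h : ∑ i, intC (b (Sum.inr i)) * intC (b (Sum.inl i)) = spinorRepLin E (lowEnd (frameSharp b)) := by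
      rw [← sum_psiNeg2_eq_lowEnd_frameSharp, map_sum]
      exact Finset.sum_congr rfl fun i _ ↦ (spinorRepLin_psiNeg2 E _ _).symm
    rw [h]
    exact spinorRepLin_mem_range_suRep (hb.lowEnd_frameSharp_mem_su hη)

end Kaehler

/-! ### §8 `ρ(𝔰𝔲(V ⊕ V̄^*)) ⊆ 𝔤_K(X; ℝ)`: block decomposition of `𝔰𝔲` and generation by `𝔰𝔲₂ ⊕ 𝔰𝔲₋₂` -/

section StandardFrame

variable (E : Type*) [NormedAddCommGroup E] [NormedSpace ℂ E] [FiniteDimensional ℂ E]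

/-- `Fin 2 × Fin n ≃ Fin n ⊕ Fin n`, `(0, k) ↦ inl k`, `(1, k) ↦ inr k`. [folklore] -/
def finTwoProdEquivSum (n : ℕ) : Fin 2 × Fin n ≃ Fin n ⊕ Fin n where
  toFun p := if p.1 = 0 then Sum.inl p.2 else Sum.inr p.2
  invFun := Sum.elim (fun k ↦ (0, k)) (fun k ↦ (1, k))
  left_inv p := by
    obtain ⟨i, k⟩ := p
    fin_cases i <;> simp
  right_inv q := by
    rcases q with k | k <;> simp

/-- **The standard split real frame `(e_k, f_k) = (c_k, i c_k)` of a complex basis `(c_k)` of `V = E`**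
(`J e_k = f_k`, `J f_k = -e_k`), used for the standard Kähler form `ω₀ = ∑ₖ e_k^* ∧ f_k^*`. [folklore] -/
def cxFrame : Module.Basis (Fin (finrank ℂ E) ⊕ Fin (finrank ℂ E)) ℝ E :=
  (Complex.basisOneI.smulTower (Module.finBasis ℂ E)).reindex (finTwoProdEquivSum (finrank ℂ E))

/-- `e_k = c_k`. [cite: Lang2002, III §6] -/
theorem cxFrame_inl (k : Fin (finrank ℂ E)) : cxFrame E (Sum.inl k) = Module.finBasis ℂ E k := by
  rw [cxFrame, Module.Basis.reindex_apply]
  change (Complex.basisOneI.smulTower (Module.finBasis ℂ E)) (0, k) = _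
  rw [Module.Basis.smulTower_apply, Complex.coe_basisOneI]
  simp

/-- `f_k = i c_k`. [cite: Lang2002, III §6] -/
theorem cxFrame_inr (k : Fin (finrank ℂ E)) : cxFrame E (Sum.inr k) = I • Module.finBasis ℂ E k := by
  rw [cxFrame, Module.Basis.reindex_apply]
  change (Complex.basisOneI.smulTower (Module.finBasis ℂ E)) (1, k) = _
  rw [Module.Basis.smulTower_apply, Complex.coe_basisOneI]
  simp

/-- `J e_k = f_k`. [cite: Lang2002, III §6] -/
theorem I_smul_cxFrame_inl (k : Fin (finrank ℂ E)) : I • cxFrame E (Sum.inl k) = cxFrame E (Sum.inr k) := by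
  rw [cxFrame_inl, cxFrame_inr]

/-- `J f_k = -e_k`. [cite: Lang2002, III §6] -/
theorem I_smul_cxFrame_inr (k : Fin (finrank ℂ E)) : I • cxFrame E (Sum.inr k) = -cxFrame E (Sum.inl k) := by
  rw [cxFrame_inl, cxFrame_inr, smul_smul, I_mul_I, neg_one_smul]

/-- `J^* e_k^* = -f_k^*` for the coframe of the standard frame. [cite: Lang2002, III §6] -/
theorem cxJt_coordCLM_inl (k : Fin (finrank ℂ E)) :
    cxJt E (coordCLM E (cxFrame E) (Sum.inl k)) = -coordCLM E (cxFrame E) (Sum.inr k) := by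
  classical
  refine ContinuousLinearMap.coe_inj.1 ((cxFrame E).ext fun p ↦ ?_)
  rw [ContinuousLinearMap.coe_coe, ContinuousLinearMap.coe_coe, cxJt_apply, _root_.neg_apply]
  rcases p with l | l
  · rw [I_smul_cxFrame_inl, coordCLM_apply_basis, coordCLM_apply_basis]
    simp
  · rw [I_smul_cxFrame_inr, map_neg, coordCLM_apply_basis, coordCLM_apply_basis]
    simp

/-- `J^* f_k^* = e_k^*` for the coframe of the standard frame. [cite: Lang2002, III §6] -/
theorem cxJt_coordCLM_inr (k : Fin (finrank ℂ E)) :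
    cxJt E (coordCLM E (cxFrame E) (Sum.inr k)) = coordCLM E (cxFrame E) (Sum.inl k) := by
  have h := congrArg (cxJt E) (cxJt_coordCLM_inl E k)
  rw [cxJt_cxJt, map_neg, neg_inj] at h
  exact h.symm

/-- `e_k^*(J u) = -f_k^*(u)`. [cite: Lang2002, III §6] -/
theorem coordCLM_inl_I_smul (k : Fin (finrank ℂ E)) (u : E) :
    coordCLM E (cxFrame E) (Sum.inl k) (I • u) = -coordCLM E (cxFrame E) (Sum.inr k) u := by
  rw [← cxJt_apply, cxJt_coordCLM_inl, _root_.neg_apply]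

/-- `f_k^*(J u) = e_k^*(u)`. [cite: Lang2002, III §6] -/
theorem coordCLM_inr_I_smul (k : Fin (finrank ℂ E)) (u : E) :
    coordCLM E (cxFrame E) (Sum.inr k) (I • u) = coordCLM E (cxFrame E) (Sum.inl k) u := by
  rw [← cxJt_apply, cxJt_coordCLM_inr]

/-- **The standard Kähler form `ω₀ = ∑ₖ e_k^* ∧ f_k^*` of the complex structure is a real `(1,1)`-form**
(`ω₀(J u, J v) = ω₀(u, v)`; it is `Im` of the standard Hermitian form of the basis `(c_k)`).
[cite: LooijengaLunts1997, §3 (3.4)] -/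
theorem frameForm_cxFrame_I_smul (u v : E) :
    frameForm (cxFrame E) ![I • u, I • v] = frameForm (cxFrame E) ![u, v] := by
  rw [frameForm_apply, frameForm_apply]
  refine Finset.sum_congr rfl fun k _ ↦ ?_
  have h1 := coordCLM_inl_I_smul E k u
  have h2 := coordCLM_inl_I_smul E k v
  have h3 := coordCLM_inr_I_smul E k u
  have h4 := coordCLM_inr_I_smul E k v
  simp only [coordCLM_apply] at h1 h2 h3 h4
  simp only [LinearMap.coe_toContinuousLinearMap', Module.Basis.coord_apply, h1, h2, h3, h4]
  ring

/-- `ω₀⁻¹ ω₀ = 1`: the sharp map of the standard frame inverts the flat map of `ω₀` on vectors too.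
[cite: LooijengaLunts1997, §3 (3.4)] -/
theorem frameSharp_flat_frameForm {n : ℕ} (b : Module.Basis (Fin n ⊕ Fin n) ℝ E) (x : E) :
    frameSharp b (flat (frameForm b) x) = x :=
  flat_injective (frameForm_nondegenerate b) (by rw [(isSymplecticBasis_frameForm b).flat_frameSharp])

end StandardFrame

section Brackets

variable {E : Type*} [NormedAddCommGroup E] [NormedSpace ℂ E] [FiniteDimensional ℂ E]

omit [FiniteDimensional ℂ E] in
/-- The commutator bracket of `𝔤𝔩(V ⊕ V^*)`, pointwise. [folklore] -/
private theorem lie_apply' (A B : Module.End ℝ (sumDual E)) (x : sumDual E) : ⁅A, B⁆ x = A (B x) - B (A x) := rfl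

/-- **`ad(ψ₋₂(P))² ψ₂(κ) = -2 ψ₋₂(P ∘ κ♭ ∘ P)`** in `𝔤𝔩(V ⊕ V^*)` (block computation; the mechanism by which
`𝔰𝔲₂` and ONE non-degenerate element of `𝔰𝔲₋₂` produce all of `𝔰𝔲₋₂`). [cite: LooijengaLunts1997, §3 (3.4)] -/
theorem lie_lowEnd_lie_lowEnd_upEnd (P : (E →L[ℝ] ℝ) →ₗ[ℝ] E) (κ : E [⋀^Fin 2]→L[ℝ] ℝ) :
    ⁅lowEnd P, ⁅lowEnd P, upEnd κ⁆⁆ = (-2 : ℝ) • lowEnd (P ∘ₗ flat κ ∘ₗ P) := by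
  refine LinearMap.ext fun x ↦ Prod.ext ?_ ?_
  · simp only [lie_apply', lowEnd_apply, upEnd_apply, map_zero, map_sub, LinearMap.smul_apply,
      LinearMap.comp_apply, Prod.fst_sub, Prod.smul_fst, sub_zero, zero_sub]
    module
  · simp

/-- **`[ψ₂(κ), ψ₋₂(P)] = ψ₀(κ♭ ∘ P)`** for a skew `P` (Looijenga–Lunts' "`[ψ₋₂(a ∧ b), ψ₂(α ∧ β)] =
ψ₀(σ(a ∧ b, α ∧ β))`", bilinearly extended, with the order of the bracket reversed).
[cite: LooijengaLunts1997, §3 (3.2) proof] -/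
theorem lie_upEnd_lowEnd {P : (E →L[ℝ] ℝ) →ₗ[ℝ] E} (hP : ∀ ξ ζ : E →L[ℝ] ℝ, ζ (P ξ) = -ξ (P ζ))
    (κ : E [⋀^Fin 2]→L[ℝ] ℝ) : ⁅upEnd κ, lowEnd P⁆ = psi0 E (flat κ ∘ₗ P) := by
  refine LinearMap.ext fun x ↦ Prod.ext ?_ ?_
  · have h1 : P (flat κ x.1) = dualTranspose E (flat κ ∘ₗ P) x.1 := by
      have h0 : P (flat κ x.1) - dualTranspose E (flat κ ∘ₗ P) x.1 = 0 :=
        eq_zero_of_forall_apply_eq_zero E fun ζ ↦ by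
          rw [map_sub, apply_dualTranspose, LinearMap.comp_apply, flat_apply, hP, flat_apply, twoForm_swap κ,
            neg_neg, sub_self]
      exact sub_eq_zero.1 h0
    simp only [lie_apply', lowEnd_apply, upEnd_apply, Prod.fst_sub, zero_sub, psi0_apply]
    rw [h1]
  · simp

/-- `ρ` of a double bracket of elements of `𝔰𝔬(V ⊕ V^*)`. [cite: LooijengaLunts1997, §3 (3.2)] -/
theorem spinorRepLin_lie_lie {A B C : Module.End ℝ (sumDual E)} (hA : A ∈ so E) (hB : B ∈ so E) (hC : C ∈ so E) :
    spinorRepLin E ⁅A, ⁅B, C⁆⁆ = ⁅spinorRepLin E A, ⁅spinorRepLin E B, spinorRepLin E C⁆⁆ := by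
  have h := (spinorRep E).map_lie ⟨A, hA⟩ ⁅(⟨B, hB⟩ : so E), ⟨C, hC⟩⁆
  rw [(spinorRep E).map_lie ⟨B, hB⟩ ⟨C, hC⟩] at h
  exact h

/-- `ρ` of a bracket of elements of `𝔰𝔬(V ⊕ V^*)`. [cite: LooijengaLunts1997, §3 (3.2)] -/
theorem spinorRepLin_lie {A B : Module.End ℝ (sumDual E)} (hA : A ∈ so E) (hB : B ∈ so E) :
    spinorRepLin E ⁅A, B⁆ = ⁅spinorRepLin E A, spinorRepLin E B⁆ :=
  (spinorRep E).map_lie ⟨A, hA⟩ ⟨B, hB⟩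

variable [Nontrivial E]

/-- **`ρ(𝔰𝔲₋₂) ⊆ 𝔤_K`**: for a skew `J`-compatible `P : V^* → V` (a `J`-invariant `2`-vector),
`ρ ψ₋₂(P) ∈ 𝔤_K(X; ℝ)` — indeed `ψ₋₂(P) = -½ ad(ψ₋₂(ω₀⁻¹))² ψ₂(κ)` with `κ♭ = ω₀♭ P ω₀♭` a real `(1,1)`-form
and `ρ ψ₋₂(ω₀⁻¹) = f_{ω₀}`, `ρ ψ₂(κ) = e_κ`. [cite: LooijengaLunts1997, §3 (3.4)] -/
theorem spinorRepLin_lowEnd_mem_kaehlerLieAlgebra {P : (E →L[ℝ] ℝ) →ₗ[ℝ] E}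
    (hP : ∀ ξ ζ : E →L[ℝ] ℝ, ζ (P ξ) = -ξ (P ζ)) (hPJ : ∀ ξ : E →L[ℝ] ℝ, P (cxJt E ξ) = -(I • P ξ)) :
    spinorRepLin E (lowEnd P) ∈ kaehlerLieAlgebra E := by
  classical
  set b := cxFrame E with hb
  set ω₀ := frameForm b
  set P₀ := frameSharp b
  have hb₀ : IsSymplecticBasis ω₀ b := isSymplecticBasis_frameForm b
  have hω₀J : ∀ u v : E, ω₀ ![I • u, I • v] = ω₀ ![u, v] := frameForm_cxFrame_I_smul E
  -- the auxiliary skew map `Φ = ω₀♭ ∘ P ∘ ω₀♭ : V → V^*` and its `2`-form `κ`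
  set Φ : E →ₗ[ℝ] (E →L[ℝ] ℝ) := flat ω₀ ∘ₗ P ∘ₗ flat ω₀ with hΦ
  have hΦskew : ∀ x y : E, Φ x y = -Φ y x := fun x y ↦ by
    simp only [hΦ, LinearMap.comp_apply, flat_apply]
    rw [twoForm_swap ω₀ (P _) y, ← flat_apply ω₀ y, hP, flat_apply, twoForm_swap ω₀ (P _) x]
  set κ : E [⋀^Fin 2]→L[ℝ] ℝ := formOfSkew Φ with hκ
  have hflatκ : flat κ = Φ := flat_formOfSkew hΦskew
  -- `κ` is `J`-invariant
  have hΦJ : ∀ v : E, Φ (I • v) = -cxJt E (Φ v) := fun v ↦ by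
    rw [hΦ]
    simp only [LinearMap.comp_apply]
    rw [flat_I_smul hω₀J, map_neg, hPJ, neg_neg, flat_I_smul hω₀J]
  have hκJ : ∀ u v : E, κ ![I • u, I • v] = κ ![u, v] := formOfSkew_I_smul hΦskew hΦJ
  -- `P = P₀ ∘ Φ ∘ P₀`
  have hPeq : P₀ ∘ₗ flat κ ∘ₗ P₀ = P := by
    rw [hflatκ, hΦ]
    refine LinearMap.ext fun ξ ↦ ?_
    simp only [LinearMap.comp_apply]
    rw [hb₀.flat_frameSharp, frameSharp_flat_frameForm]
  -- the double bracket
  have key : lowEnd P = (-1 / 2 : ℝ) • ⁅lowEnd P₀, ⁅lowEnd P₀, upEnd κ⁆⁆ := by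
    rw [lie_lowEnd_lie_lowEnd_upEnd, hPeq, smul_smul]
    norm_num
  have hP₀so : lowEnd P₀ ∈ so E := su_le_so E (hb₀.lowEnd_frameSharp_mem_su hω₀J)
  rw [key, map_smul, spinorRepLin_lie_lie hP₀so hP₀so (upEnd_mem_so κ)]
  refine (kaehlerLieAlgebra E).smul_mem _
    ((kaehlerLieAlgebra E).lie_mem ?_ ((kaehlerLieAlgebra E).lie_mem ?_ ?_))
  · rw [← sum_psiNeg2_eq_lowEnd_frameSharp, map_sum]
    simp_rw [spinorRepLin_psiNeg2]
    rw [← hb₀.lefschetzDualG_eq_sum_intC_mul]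
    exact lefschetzDualG_mem_kaehlerLieAlgebra hω₀J hb₀.nondegenerate
  · rw [← sum_psiNeg2_eq_lowEnd_frameSharp, map_sum]
    simp_rw [spinorRepLin_psiNeg2]
    rw [← hb₀.lefschetzDualG_eq_sum_intC_mul]
    exact lefschetzDualG_mem_kaehlerLieAlgebra hω₀J hb₀.nondegenerate
  · rw [spinorRepLin_upEnd]
    exact lefschetzG_mem_kaehlerLieAlgebra hκJ

/-- **`ρ[𝔰𝔲₂, 𝔰𝔲₋₂] ⊆ 𝔤_K`**: `ρ ψ₀(κ♭ ∘ P) ∈ 𝔤_K(X; ℝ)` for a skew `J`-compatible `P` and a real `(1,1)`-form `κ`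
(`ψ₀(κ♭ ∘ P) = [ψ₂(κ), ψ₋₂(P)]`). [cite: LooijengaLunts1997, §3 (3.4)] -/
theorem spinorRepLin_psi0_flat_comp_mem_kaehlerLieAlgebra {P : (E →L[ℝ] ℝ) →ₗ[ℝ] E}
    (hP : ∀ ξ ζ : E →L[ℝ] ℝ, ζ (P ξ) = -ξ (P ζ)) (hPJ : ∀ ξ : E →L[ℝ] ℝ, P (cxJt E ξ) = -(I • P ξ))
    {κ : E [⋀^Fin 2]→L[ℝ] ℝ} (hκ : ∀ u v : E, κ ![I • u, I • v] = κ ![u, v]) :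
    spinorRepLin E (psi0 E (flat κ ∘ₗ P)) ∈ kaehlerLieAlgebra E := by
  rw [← lie_upEnd_lowEnd hP, spinorRepLin_lie (upEnd_mem_so κ) ((lowEnd_mem_so_iff P).2 hP), spinorRepLin_upEnd]
  exact (kaehlerLieAlgebra E).lie_mem (lefschetzG_mem_kaehlerLieAlgebra hκ)
    (spinorRepLin_lowEnd_mem_kaehlerLieAlgebra hP hPJ)

end Brackets

section DegreeZero

variable (E : Type*) [NormedAddCommGroup E] [NormedSpace ℂ E] [FiniteDimensional ℂ E]

/-! #### `J`-invariant `2`-vectors and `2`-forms, and the complex rank-one operators of `𝔤𝔩(V̄^*)` -/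

variable {E} in
/-- The `2`-vector `a ∧ a'` as a map `V^* → V`, `ξ ↦ ξ(a) a' - ξ(a') a` (the block of `ψ₋₂(a ∧ a')`).
[cite: LooijengaLunts1997, §3 (3.1)] -/
def biv (a a' : E) : (E →L[ℝ] ℝ) →ₗ[ℝ] E := (evalDual E a).smulRight a' - (evalDual E a').smulRight a

omit [FiniteDimensional ℂ E] in
/-- unfolding of `biv`. [cite: LooijengaLunts1997, §3 (3.1)] -/
@[simp]
theorem biv_apply (a a' : E) (ξ : E →L[ℝ] ℝ) : biv a a' ξ = ξ a • a' - ξ a' • a := by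
  simp [biv]

omit [FiniteDimensional ℂ E] in
/-- `2`-vectors are skew: `ζ((a ∧ a')ξ) = -ξ((a ∧ a')ζ)`. [cite: LooijengaLunts1997, §3 (3.1)] -/
theorem biv_skew (a a' : E) (ξ ζ : E →L[ℝ] ℝ) : ζ (biv a a' ξ) = -ξ (biv a a' ζ) := by
  simp only [biv_apply, map_sub, map_smul, smul_eq_mul]
  ring

omit [FiniteDimensional ℂ E] in
/-- A sum of two `2`-vectors is skew. [cite: LooijengaLunts1997, §3 (3.1)] -/
theorem biv_add_biv_skew (a a' c c' : E) (ξ ζ : E →L[ℝ] ℝ) :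
    ζ ((biv a a' + biv c c') ξ) = -ξ ((biv a a' + biv c c') ζ) := by
  rw [LinearMap.add_apply, LinearMap.add_apply, map_add, map_add, biv_skew E a a', biv_skew E c c', neg_add]

omit [FiniteDimensional ℂ E] in
/-- **`a ∧ Ja` is a `J`-invariant `2`-vector** (`(a ∧ Ja) J^* = -J (a ∧ Ja)`). [cite: LooijengaLunts1997, §3 (3.4)] -/
theorem biv_I_smul_J (a : E) (ξ : E →L[ℝ] ℝ) : biv a (I • a) (cxJt E ξ) = -(I • biv a (I • a) ξ) := by
  have hu : I • (I • a) = -a := by rw [smul_smul, I_mul_I, neg_one_smul]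
  simp only [biv_apply, cxJt_apply, hu, map_neg, smul_sub, smul_comm I (ξ a) (I • a), smul_comm I (ξ (I • a)) a,
    neg_smul, smul_neg]
  abel

omit [FiniteDimensional ℂ E] in
/-- **`a ∧ a' + Ja ∧ Ja'` is a `J`-invariant `2`-vector.** [cite: LooijengaLunts1997, §3 (3.4)] -/
theorem biv_add_biv_I_smul_J (a a' : E) (ξ : E →L[ℝ] ℝ) :
    (biv a a' + biv (I • a) (I • a')) (cxJt E ξ) = -(I • (biv a a' + biv (I • a) (I • a')) ξ) := by
  have hu : I • (I • a) = -a := by rw [smul_smul, I_mul_I, neg_one_smul]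
  have hu' : I • (I • a') = -a' := by rw [smul_smul, I_mul_I, neg_one_smul]
  simp only [LinearMap.add_apply, biv_apply, cxJt_apply, hu, hu', map_neg, smul_add, smul_sub,
    smul_comm I (ξ a) a', smul_comm I (ξ a') a, smul_comm I (ξ (I • a)) (I • a'), smul_comm I (ξ (I • a')) (I • a),
    neg_smul, smul_neg]
  abel

variable {E} in
/-- The `2`-form `α ∧ β` of two real covectors (`(α ∧ β)(u, v) = α(u)β(v) - α(v)β(u)`). [folklore] -/
def pairForm (α β : E →L[ℝ] ℝ) : E [⋀^Fin 2]→L[ℝ] ℝ :=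
  wedgeOne α (wedgeOne β (ContinuousAlternatingMap.constOfIsEmpty ℝ E (Fin 0) (1 : ℝ)))

omit [FiniteDimensional ℂ E] in
/-- `(α ∧ β)(u, v) = α(u)β(v) - α(v)β(u)`. [cite: Warner1983, 2.10–2.11] -/
@[simp]
theorem pairForm_apply (α β : E →L[ℝ] ℝ) (u v : E) : pairForm α β ![u, v] = α u * β v - α v * β u :=
  wedgePair_apply α β u v

omit [FiniteDimensional ℂ E] in
/-- **`α ∧ J^*α` is a real `(1,1)`-form.** [cite: LooijengaLunts1997, §3 (3.4)] -/
theorem pairForm_cxJt_J (α : E →L[ℝ] ℝ) (u v : E) :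
    pairForm α (cxJt E α) ![I • u, I • v] = pairForm α (cxJt E α) ![u, v] := by
  simp only [pairForm_apply, cxJt_apply, smul_smul, I_mul_I, neg_one_smul, map_neg]
  ring

omit [FiniteDimensional ℂ E] in
/-- **`α ∧ β + J^*α ∧ J^*β` is a real `(1,1)`-form.** [cite: LooijengaLunts1997, §3 (3.4)] -/
theorem pairForm_add_cxJt_J (α β : E →L[ℝ] ℝ) (u v : E) :
    (pairForm α β + pairForm (cxJt E α) (cxJt E β)) ![I • u, I • v] =
      (pairForm α β + pairForm (cxJt E α) (cxJt E β)) ![u, v] := by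
  simp only [ContinuousAlternatingMap.add_apply, pairForm_apply, cxJt_apply, smul_smul, I_mul_I, neg_one_smul, map_neg]
  ring

omit [FiniteDimensional ℂ E] in
/-- **`α ∧ J^*β + β ∧ J^*α` is a real `(1,1)`-form.** [cite: LooijengaLunts1997, §3 (3.4)] -/
theorem pairForm_cxJt_add_J (α β : E →L[ℝ] ℝ) (u v : E) :
    (pairForm α (cxJt E β) + pairForm β (cxJt E α)) ![I • u, I • v] =
      (pairForm α (cxJt E β) + pairForm β (cxJt E α)) ![u, v] := by
  simp only [ContinuousAlternatingMap.add_apply, pairForm_apply, cxJt_apply, smul_smul, I_mul_I, neg_one_smul, map_neg]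
  ring

/-- **The complex rank-one operators `ξ ↦ ξ(a) β - ξ(Ja) J^*β` of `𝔤𝔩(V̄^*)`** (they commute with `J^*`; over a
complex basis `(c_k)` with coframe `(z_k)` they are the real and imaginary parts of the complex matrix units),
linearly in `β`. [cite: LooijengaLunts1997, §3 (3.4)] -/
def cxRankOne (a : E) : (E →L[ℝ] ℝ) →ₗ[ℝ] Module.End ℝ (E →L[ℝ] ℝ) where
  toFun β := rankOne E a β + rankOne E (I • a) (-cxJt E β)
  map_add' β β' := by
    refine LinearMap.ext fun ξ ↦ ContinuousLinearMap.ext fun w ↦ ?_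
    simp only [LinearMap.add_apply, rankOne_apply, map_add, neg_add, _root_.add_apply, _root_.smul_apply,
      _root_.neg_apply, smul_eq_mul]
    ring
  map_smul' c β := by
    refine LinearMap.ext fun ξ ↦ ContinuousLinearMap.ext fun w ↦ ?_
    simp only [LinearMap.add_apply, LinearMap.smul_apply, rankOne_apply, map_smul, _root_.add_apply,
      _root_.smul_apply, _root_.neg_apply, smul_eq_mul, RingHom.id_apply, smul_neg]
    ring

omit [FiniteDimensional ℂ E] in
/-- `(cxRankOne a β) ξ w = ξ(a) β(w) - ξ(Ja) β(Jw)`. [cite: LooijengaLunts1997, §3 (3.4)] -/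
@[simp]
theorem cxRankOne_apply_apply (a : E) (β ξ : E →L[ℝ] ℝ) (w : E) :
    cxRankOne E a β ξ w = ξ a * β w - ξ (I • a) * β (I • w) := by
  simp only [cxRankOne, LinearMap.coe_mk, AddHom.coe_mk, LinearMap.add_apply, rankOne_apply, _root_.add_apply,
    _root_.smul_apply, _root_.neg_apply, cxJt_apply, smul_eq_mul]
  ring

/-! #### Coordinates of the standard frame -/

/-- `e_k^*(e_l) = δ_{kl}`. [cite: Lang2002, III §6] -/
theorem x_apply_e (k l : Fin (finrank ℂ E)) : (coordCLM E (cxFrame E) (Sum.inl k)) (cxFrame E (Sum.inl l)) = if l = k then 1 else 0 := by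
  classical
  rw [coordCLM_apply_basis]; simp

/-- `e_k^*(f_l) = 0`. [cite: Lang2002, III §6] -/
@[simp]
theorem x_apply_f (k l : Fin (finrank ℂ E)) : (coordCLM E (cxFrame E) (Sum.inl k)) (cxFrame E (Sum.inr l)) = 0 := by
  classical
  rw [coordCLM_apply_basis]; simp

/-- `f_k^*(e_l) = 0`. [cite: Lang2002, III §6] -/
@[simp]
theorem y_apply_e (k l : Fin (finrank ℂ E)) : (coordCLM E (cxFrame E) (Sum.inr k)) (cxFrame E (Sum.inl l)) = 0 := by
  classical
  rw [coordCLM_apply_basis]; simp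

/-- `f_k^*(f_l) = δ_{kl}`. [cite: Lang2002, III §6] -/
theorem y_apply_f (k l : Fin (finrank ℂ E)) : (coordCLM E (cxFrame E) (Sum.inr k)) (cxFrame E (Sum.inr l)) = if l = k then 1 else 0 := by
  classical
  rw [coordCLM_apply_basis]; simp

/-! #### The four products: complex matrix units as `κ♭ ∘ P` with `κ` a real `(1,1)`-form, `P` a `J`-invariant
`2`-vector -/

/-- `(e_k^* ∧ J^*e_k^*)♭ ∘ (e_k ∧ Je_k)` is the complex rank-one operator of `(e_k, e_k^*)` (a real diagonal matrix
unit). [cite: LooijengaLunts1997, §3 (3.4)] -/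
theorem flat_pairForm_comp_biv_diag (k : Fin (finrank ℂ E)) :
    flat (pairForm (coordCLM E (cxFrame E) (Sum.inl k)) (cxJt E (coordCLM E (cxFrame E) (Sum.inl k)))) ∘ₗ biv (cxFrame E (Sum.inl k)) (I • (cxFrame E (Sum.inl k))) = cxRankOne E (cxFrame E (Sum.inl k)) (coordCLM E (cxFrame E) (Sum.inl k)) := by
  classical
  refine LinearMap.ext fun ξ ↦ ContinuousLinearMap.ext fun w ↦ ?_
  simp only [LinearMap.comp_apply, biv_apply, map_sub, map_smul, _root_.sub_apply, _root_.smul_apply, flat_apply,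
    pairForm_apply, cxRankOne_apply_apply, cxJt_apply, I_smul_cxFrame_inl, coordCLM_inl_I_smul, smul_eq_mul,
    x_apply_e, x_apply_f, y_apply_f, if_true]
  ring

/-- `(e_k^* ∧ e_l^* + J^*e_k^* ∧ J^*e_l^*)♭ ∘ (e_k ∧ Je_k)`, `k ≠ l`, is the complex rank-one operator of
`(e_k, f_l^*)` (an imaginary off-diagonal matrix unit). [cite: LooijengaLunts1997, §3 (3.4)] -/
theorem flat_pairForm_add_comp_biv {k l : Fin (finrank ℂ E)} (hkl : k ≠ l) :
    flat (pairForm (coordCLM E (cxFrame E) (Sum.inl k)) (coordCLM E (cxFrame E) (Sum.inl l)) + pairForm (cxJt E (coordCLM E (cxFrame E) (Sum.inl k))) (cxJt E (coordCLM E (cxFrame E) (Sum.inl l)))) ∘ₗ biv (cxFrame E (Sum.inl k)) (I • (cxFrame E (Sum.inl k))) =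
      cxRankOne E (cxFrame E (Sum.inl k)) (coordCLM E (cxFrame E) (Sum.inr l)) := by
  classical
  refine LinearMap.ext fun ξ ↦ ContinuousLinearMap.ext fun w ↦ ?_
  simp only [LinearMap.comp_apply, biv_apply, map_sub, map_smul, _root_.sub_apply, _root_.smul_apply, flat_apply,
    ContinuousAlternatingMap.add_apply, pairForm_apply, cxRankOne_apply_apply, cxJt_apply, I_smul_cxFrame_inl,
    coordCLM_inl_I_smul, coordCLM_inr_I_smul, smul_eq_mul, x_apply_e, x_apply_f, y_apply_f, if_true, if_neg hkl]
  ring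

/-- `(e_k^* ∧ J^*e_l^* + e_l^* ∧ J^*e_k^*)♭ ∘ (e_k ∧ Je_k)`, `k ≠ l`, is the complex rank-one operator of
`(e_k, e_l^*)` (a real off-diagonal matrix unit). [cite: LooijengaLunts1997, §3 (3.4)] -/
theorem flat_pairForm_cxJt_add_comp_biv {k l : Fin (finrank ℂ E)} (hkl : k ≠ l) :
    flat (pairForm (coordCLM E (cxFrame E) (Sum.inl k)) (cxJt E (coordCLM E (cxFrame E) (Sum.inl l))) + pairForm (coordCLM E (cxFrame E) (Sum.inl l)) (cxJt E (coordCLM E (cxFrame E) (Sum.inl k)))) ∘ₗ biv (cxFrame E (Sum.inl k)) (I • (cxFrame E (Sum.inl k))) =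
      cxRankOne E (cxFrame E (Sum.inl k)) (coordCLM E (cxFrame E) (Sum.inl l)) := by
  classical
  refine LinearMap.ext fun ξ ↦ ContinuousLinearMap.ext fun w ↦ ?_
  simp only [LinearMap.comp_apply, biv_apply, map_sub, map_smul, _root_.sub_apply, _root_.smul_apply, flat_apply,
    ContinuousAlternatingMap.add_apply, pairForm_apply, cxRankOne_apply_apply, cxJt_apply, I_smul_cxFrame_inl,
    coordCLM_inl_I_smul, smul_eq_mul, x_apply_e, x_apply_f, y_apply_f, if_true, if_neg hkl]
  ring

/-- `(e_k^* ∧ J^*e_l^* + e_l^* ∧ J^*e_k^*)♭ ∘ (e_k ∧ e_l + Je_k ∧ Je_l)`, `k ≠ l`, is the difference of the complex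
rank-one operators of `(e_l, f_l^*)` and `(e_k, f_k^*)` (a traceless imaginary diagonal matrix).
[cite: LooijengaLunts1997, §3 (3.4)] -/
theorem flat_pairForm_cxJt_add_comp_biv_add {k l : Fin (finrank ℂ E)} (hkl : k ≠ l) :
    flat (pairForm (coordCLM E (cxFrame E) (Sum.inl k)) (cxJt E (coordCLM E (cxFrame E) (Sum.inl l))) + pairForm (coordCLM E (cxFrame E) (Sum.inl l)) (cxJt E (coordCLM E (cxFrame E) (Sum.inl k)))) ∘ₗ
        (biv (cxFrame E (Sum.inl k)) (cxFrame E (Sum.inl l)) + biv (I • (cxFrame E (Sum.inl k))) (I • (cxFrame E (Sum.inl l)))) =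
      cxRankOne E (cxFrame E (Sum.inl l)) (coordCLM E (cxFrame E) (Sum.inr l)) - cxRankOne E (cxFrame E (Sum.inl k)) (coordCLM E (cxFrame E) (Sum.inr k)) := by
  classical
  refine LinearMap.ext fun ξ ↦ ContinuousLinearMap.ext fun w ↦ ?_
  rw [LinearMap.sub_apply, _root_.sub_apply]
  simp only [LinearMap.comp_apply, LinearMap.add_apply, biv_apply, map_sub, map_add, map_smul, _root_.sub_apply,
    _root_.add_apply, _root_.smul_apply, flat_apply, ContinuousAlternatingMap.add_apply, pairForm_apply,
    cxRankOne_apply_apply, cxJt_apply, I_smul_cxFrame_inl, coordCLM_inl_I_smul, coordCLM_inr_I_smul,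
    smul_eq_mul, x_apply_e, x_apply_f, y_apply_f, if_true, if_neg hkl.symm, if_neg hkl]
  ring

/-! #### The degree-`0` preimage of `𝔤_K` under `ρ ∘ ψ₀` contains the traceless part of `𝔤𝔩_ℂ(V̄^*)` -/

/-- The `σ ∈ 𝔤𝔩(V^*)` with `ρ ψ₀(σ) ∈ 𝔤_K(X; ℝ)`, a real subspace. [cite: LooijengaLunts1997, §3 (3.4)] -/
def psi0Preimage : Submodule ℝ (Module.End ℝ (E →L[ℝ] ℝ)) where
  carrier := {σ | spinorRepLin E (psi0 E σ) ∈ kaehlerLieAlgebra E}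
  add_mem' {σ τ} hσ hτ := by
    simp only [Set.mem_setOf_eq, psi0_add, map_add]
    exact add_mem hσ hτ
  zero_mem' := by
    have h : psi0 E (0 : Module.End ℝ (E →L[ℝ] ℝ)) = 0 := by
      have := psi0_smul E (0 : ℝ) (0 : Module.End ℝ (E →L[ℝ] ℝ))
      rwa [zero_smul, zero_smul] at this
    simp only [Set.mem_setOf_eq, h, map_zero]
    exact zero_mem _
  smul_mem' c σ hσ := by
    simp only [Set.mem_setOf_eq, psi0_smul, map_smul]
    exact (kaehlerLieAlgebra E).smul_mem c hσ

/-- Membership in `psi0Preimage`. [cite: LooijengaLunts1997, §3 (3.4)] -/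
theorem mem_psi0Preimage_iff (σ : Module.End ℝ (E →L[ℝ] ℝ)) :
    σ ∈ psi0Preimage E ↔ spinorRepLin E (psi0 E σ) ∈ kaehlerLieAlgebra E := Iff.rfl

variable [Nontrivial E]

/-- The complex rank-one operator of `(e_k, e_l^*)` has `ρ ψ₀`-image in `𝔤_K`. [cite: LooijengaLunts1997, §3 (3.4)] -/
theorem cxRankOne_e_x_mem (k l : Fin (finrank ℂ E)) : cxRankOne E (cxFrame E (Sum.inl k)) (coordCLM E (cxFrame E) (Sum.inl l)) ∈ psi0Preimage E := by
  rw [mem_psi0Preimage_iff]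
  by_cases hkl : k = l
  · subst hkl
    rw [← flat_pairForm_comp_biv_diag]
    exact spinorRepLin_psi0_flat_comp_mem_kaehlerLieAlgebra (biv_skew E _ _) (biv_I_smul_J E _) (pairForm_cxJt_J E _)
  · rw [← flat_pairForm_cxJt_add_comp_biv E hkl]
    exact spinorRepLin_psi0_flat_comp_mem_kaehlerLieAlgebra (biv_skew E _ _) (biv_I_smul_J E _)
      (pairForm_cxJt_add_J E _ _)

/-- The complex rank-one operator of `(e_k, f_l^*)`, `k ≠ l`, has `ρ ψ₀`-image in `𝔤_K`.
[cite: LooijengaLunts1997, §3 (3.4)] -/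
theorem cxRankOne_e_y_mem {k l : Fin (finrank ℂ E)} (hkl : k ≠ l) : cxRankOne E (cxFrame E (Sum.inl k)) (coordCLM E (cxFrame E) (Sum.inr l)) ∈ psi0Preimage E := by
  rw [mem_psi0Preimage_iff, ← flat_pairForm_add_comp_biv E hkl]
  exact spinorRepLin_psi0_flat_comp_mem_kaehlerLieAlgebra (biv_skew E _ _) (biv_I_smul_J E _) (pairForm_add_cxJt_J E _ _)

/-- The difference of the operators of `(e_l, f_l^*)` and `(e_k, f_k^*)` has `ρ ψ₀`-image in `𝔤_K`.
[cite: LooijengaLunts1997, §3 (3.4)] -/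
theorem cxRankOne_e_y_sub_mem (k l : Fin (finrank ℂ E)) :
    cxRankOne E (cxFrame E (Sum.inl l)) (coordCLM E (cxFrame E) (Sum.inr l)) - cxRankOne E (cxFrame E (Sum.inl k)) (coordCLM E (cxFrame E) (Sum.inr k)) ∈ psi0Preimage E := by
  by_cases hkl : k = l
  · subst hkl
    have h : cxRankOne E (cxFrame E (Sum.inl k)) (coordCLM E (cxFrame E) (Sum.inr k)) -
        cxRankOne E (cxFrame E (Sum.inl k)) (coordCLM E (cxFrame E) (Sum.inr k)) = 0 :=
      sub_self (cxRankOne E (cxFrame E (Sum.inl k)) (coordCLM E (cxFrame E) (Sum.inr k)))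
    rw [h]
    exact zero_mem _
  · rw [mem_psi0Preimage_iff, ← flat_pairForm_cxJt_add_comp_biv_add E hkl]
    exact spinorRepLin_psi0_flat_comp_mem_kaehlerLieAlgebra (biv_add_biv_skew E _ _ _ _) (biv_add_biv_I_smul_J E _ _)
      (pairForm_cxJt_add_J E _ _)

/-- **`ρ(𝔰𝔲₀) ⊆ 𝔤_K`**: for `σ ∈ 𝔤𝔩(V^*)` commuting with `J^*` and with `Tr_ℝ(J^* σ) = 0` (i.e. `σ ∈ 𝔤𝔩_ℂ(V̄^*)`
with `Im Tr_ℂ σ = 0`), `ρ ψ₀(σ) ∈ 𝔤_K(X; ℝ)` — `σ` is a real combination of the products `κ♭ ∘ P` of real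
`(1,1)`-forms `κ` and `J`-invariant `2`-vectors `P`, the diagonal imaginary units only through traceless
differences. [cite: LooijengaLunts1997, §3 (3.4)] -/
theorem spinorRepLin_psi0_mem_kaehlerLieAlgebra {σ : Module.End ℝ (E →L[ℝ] ℝ)}
    (hσJ : ∀ ξ : E →L[ℝ] ℝ, σ (cxJt E ξ) = cxJt E (σ ξ)) (hσtr : LinearMap.trace ℝ _ (cxJt E * σ) = 0) :
    spinorRepLin E (psi0 E σ) ∈ kaehlerLieAlgebra E := by
  classical
  -- `σ(f_k^*) = -J^* σ(e_k^*)`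
  have hy : ∀ k, σ (coordCLM E (cxFrame E) (Sum.inr k)) = -cxJt E (σ (coordCLM E (cxFrame E) (Sum.inl k))) := fun k ↦ by
    rw [← hσJ, cxJt_coordCLM_inl, map_neg, neg_neg]
  -- the coefficients
  set a : Fin (finrank ℂ E) → Fin (finrank ℂ E) → ℝ := fun k l ↦ σ (coordCLM E (cxFrame E) (Sum.inl k)) (cxFrame E (Sum.inl l)) with ha
  set c : Fin (finrank ℂ E) → Fin (finrank ℂ E) → ℝ := fun k l ↦ σ (coordCLM E (cxFrame E) (Sum.inl k)) (cxFrame E (Sum.inr l)) with hc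
  -- the trace condition: `∑ₖ c k k = 0`
  have hcc : ∑ k, c k k = 0 := by
    have h := hσtr
    rw [trace_eq_sum_apply E (cxFrame E), Fintype.sum_sum_type] at h
    simp only [Module.End.mul_apply, cxJt_apply, I_smul_cxFrame_inl, I_smul_cxFrame_inr, map_neg, hy,
      _root_.neg_apply, neg_neg] at h
    have h2 : ∑ k, σ (coordCLM E (cxFrame E) (Sum.inl k)) (cxFrame E (Sum.inr k)) + ∑ k, σ (coordCLM E (cxFrame E) (Sum.inl k)) (cxFrame E (Sum.inr k)) = 0 := h
    simp only [hc]
    linarith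
  -- `σ = ∑ₖ cxRankOne e_k (σ e_k^*)`
  have hβ : σ = ∑ k, cxRankOne E (cxFrame E (Sum.inl k)) (σ (coordCLM E (cxFrame E) (Sum.inl k))) := by
    conv_lhs => rw [eq_sum_rankOne E (cxFrame E) σ, Fintype.sum_sum_type, ← Finset.sum_add_distrib]
    refine Finset.sum_congr rfl fun k _ ↦ ?_
    change rankOne E (cxFrame E (Sum.inl k)) (σ (coordCLM E (cxFrame E) (Sum.inl k))) + rankOne E (cxFrame E (Sum.inr k)) (σ (coordCLM E (cxFrame E) (Sum.inr k))) = rankOne E (cxFrame E (Sum.inl k)) (σ (coordCLM E (cxFrame E) (Sum.inl k))) +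
      rankOne E (I • (cxFrame E (Sum.inl k))) (-cxJt E (σ (coordCLM E (cxFrame E) (Sum.inl k))))
    rw [hy, I_smul_cxFrame_inl]
  -- expansion of each term in the coframe
  have hexp : ∀ k, cxRankOne E (cxFrame E (Sum.inl k)) (σ (coordCLM E (cxFrame E) (Sum.inl k))) = ∑ l, a k l • cxRankOne E (cxFrame E (Sum.inl k)) (coordCLM E (cxFrame E) (Sum.inl l)) +
      ∑ l, c k l • cxRankOne E (cxFrame E (Sum.inl k)) (coordCLM E (cxFrame E) (Sum.inr l)) := fun k ↦ by
    conv_lhs => rw [← sum_apply_smul_coordCLM E (cxFrame E) (σ (coordCLM E (cxFrame E) (Sum.inl k)))]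
    rw [map_sum, Fintype.sum_sum_type]
    simp only [map_smul, ha, hc]
  -- regrouping: off-diagonal + diagonal
  have hσ' : σ = (∑ k, ((∑ l, a k l • cxRankOne E (cxFrame E (Sum.inl k)) (coordCLM E (cxFrame E) (Sum.inl l))) +
      ∑ l ∈ Finset.univ.erase k, c k l • cxRankOne E (cxFrame E (Sum.inl k)) (coordCLM E (cxFrame E) (Sum.inr l)))) + ∑ k, c k k • cxRankOne E (cxFrame E (Sum.inl k)) (coordCLM E (cxFrame E) (Sum.inr k)) := by
    rw [hβ, ← Finset.sum_add_distrib]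
    refine Finset.sum_congr rfl fun k _ ↦ ?_
    rw [hexp k, add_assoc, Finset.sum_erase_add _ _ (Finset.mem_univ k)]
  -- the diagonal: `∑ₖ c_kk W_kk = ∑ₖ c_kk (W_kk - W_{k₀k₀})` since `∑ₖ c_kk = 0`
  obtain ⟨k₀⟩ : Nonempty (Fin (finrank ℂ E)) := ⟨⟨0, Module.finrank_pos⟩⟩
  have hdiag : ∑ k, c k k • cxRankOne E (cxFrame E (Sum.inl k)) (coordCLM E (cxFrame E) (Sum.inr k)) =
      ∑ k, c k k • (cxRankOne E (cxFrame E (Sum.inl k)) (coordCLM E (cxFrame E) (Sum.inr k)) - cxRankOne E (cxFrame E (Sum.inl k₀)) (coordCLM E (cxFrame E) (Sum.inr k₀))) := by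
    refine LinearMap.ext fun ξ ↦ ?_
    simp only [LinearMap.coe_sum, Finset.sum_apply, LinearMap.smul_apply, LinearMap.sub_apply, smul_sub,
      Finset.sum_sub_distrib, ← Finset.sum_smul, hcc, zero_smul, sub_zero]
  rw [hσ', hdiag, psi0_add, map_add]
  have hmem : ∀ τ ∈ psi0Preimage E, spinorRepLin E (psi0 E τ) ∈ kaehlerLieAlgebra E := fun τ h ↦ h
  refine add_mem (hmem _ (Submodule.sum_mem _ fun k _ ↦ Submodule.add_mem _
    (Submodule.sum_mem _ fun l _ ↦ Submodule.smul_mem _ _ (cxRankOne_e_x_mem E k l))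
    (Submodule.sum_mem _ fun l hl ↦ Submodule.smul_mem _ _ (cxRankOne_e_y_mem E (Finset.ne_of_mem_erase hl).symm))))
    (hmem _ (Submodule.sum_mem _ fun k _ ↦ Submodule.smul_mem _ _ (cxRankOne_e_y_sub_mem E k₀ k)))

end DegreeZero






/-! ### §9 Block decomposition of `𝔰𝔲(V ⊕ V̄^*)` and the identification `𝔤_K(X; ℝ) = ρ(𝔰𝔲(V ⊕ V̄^*))` -/

section Blocks

variable {E : Type*} [NormedAddCommGroup E] [NormedSpace ℂ E] [FiniteDimensional ℂ E]
  {T : Module.End ℝ (sumDual E)}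

variable (T) in
/-- The degree-`-2` block `V^* → V` of `T ∈ 𝔤𝔩(V ⊕ V^*)`. [cite: LooijengaLunts1997, §3 (3.1)] -/
def blkP : (E →L[ℝ] ℝ) →ₗ[ℝ] E := LinearMap.fst ℝ E (E →L[ℝ] ℝ) ∘ₗ T ∘ₗ LinearMap.inr ℝ E (E →L[ℝ] ℝ)

variable (T) in
/-- The degree-`0` block `V^* → V^*` of `T ∈ 𝔤𝔩(V ⊕ V^*)`. [cite: LooijengaLunts1997, §3 (3.1)] -/
def blkD : Module.End ℝ (E →L[ℝ] ℝ) := LinearMap.snd ℝ E (E →L[ℝ] ℝ) ∘ₗ T ∘ₗ LinearMap.inr ℝ E (E →L[ℝ] ℝ)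

variable (T) in
/-- The degree-`2` block `V → V^*` of `T ∈ 𝔤𝔩(V ⊕ V^*)`. [cite: LooijengaLunts1997, §3 (3.1)] -/
def blkΦ : E →ₗ[ℝ] (E →L[ℝ] ℝ) := LinearMap.snd ℝ E (E →L[ℝ] ℝ) ∘ₗ T ∘ₗ LinearMap.inl ℝ E (E →L[ℝ] ℝ)

omit [FiniteDimensional ℂ E] in
/-- unfolding of `blkP`. [cite: LooijengaLunts1997, §3 (3.1)] -/
@[simp]
theorem blkP_apply (ξ : E →L[ℝ] ℝ) : blkP T ξ = (T (0, ξ)).1 := rfl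

omit [FiniteDimensional ℂ E] in
/-- unfolding of `blkD`. [cite: LooijengaLunts1997, §3 (3.1)] -/
@[simp]
theorem blkD_apply (ξ : E →L[ℝ] ℝ) : blkD T ξ = (T (0, ξ)).2 := rfl

omit [FiniteDimensional ℂ E] in
/-- unfolding of `blkΦ`. [cite: LooijengaLunts1997, §3 (3.1)] -/
@[simp]
theorem blkΦ_apply (v : E) : blkΦ T v = (T (v, 0)).2 := rfl

omit [FiniteDimensional ℂ E] in
/-- For `T ∈ 𝔰𝔬(V ⊕ V^*)` the block `V^* → V` is skew. [cite: LooijengaLunts1997, §3 (3.1)] -/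
theorem blkP_skew (hT : T ∈ so E) (ξ ζ : E →L[ℝ] ℝ) : ζ (blkP T ξ) = -ξ (blkP T ζ) := by
  have h := (mem_so_iff E T).1 hT (0, ξ) (0, ζ)
  simpa [splitForm_apply] using h

omit [FiniteDimensional ℂ E] in
/-- For `T ∈ 𝔰𝔬(V ⊕ V^*)` the block `V → V^*` is skew. [cite: LooijengaLunts1997, §3 (3.1)] -/
theorem blkΦ_skew (hT : T ∈ so E) (v w : E) : blkΦ T v w = -blkΦ T w v := by
  have h := (mem_so_iff E T).1 hT (v, 0) (w, 0)
  simpa [splitForm_apply] using h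

/-- For `T ∈ 𝔰𝔬(V ⊕ V^*)` the block `V → V` is minus the transpose of the block `V^* → V^*`.
[cite: LooijengaLunts1997, §3 (3.1)] -/
theorem fst_apply_inl_eq (hT : T ∈ so E) (v : E) : (T (v, 0)).1 = -dualTranspose E (blkD T) v := by
  have h0 : (T (v, 0)).1 + dualTranspose E (blkD T) v = 0 :=
    eq_zero_of_forall_apply_eq_zero E fun ζ ↦ by
      have h := (mem_so_iff E T).1 hT (v, 0) (0, ζ)
      simp only [splitForm_apply, map_zero, _root_.zero_apply, zero_add] at h
      rw [map_add, apply_dualTranspose, blkD_apply, h, neg_add_cancel]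
  exact eq_neg_of_add_eq_zero_left h0

/-- **Block decomposition of `𝔰𝔬(V ⊕ V^*) = 𝔰𝔬₋₂ ⊕ 𝔰𝔬₀ ⊕ 𝔰𝔬₂`**: every `T ∈ 𝔰𝔬(V ⊕ V^*)` is
`ψ₋₂(P) + ψ₀(σ) + ψ₂(κ)` with `P` its (skew) block `V^* → V`, `σ` its block `V^* → V^*` and `κ` the `2`-form of
its (skew) block `V → V^*` ("a grading … with degrees `2`, `0` and `-2`"). [cite: LooijengaLunts1997, §3 (3.1)] -/
theorem eq_blocks (hT : T ∈ so E) : T = lowEnd (blkP T) + psi0 E (blkD T) + upEnd (formOfSkew (blkΦ T)) := by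
  refine LinearMap.ext fun x ↦ ?_
  have hx : x = (x.1, (0 : E →L[ℝ] ℝ)) + ((0 : E), x.2) := by ext <;> simp
  conv_lhs => rw [hx, map_add]
  refine Prod.ext ?_ ?_
  · rw [Prod.fst_add, LinearMap.add_apply, LinearMap.add_apply, Prod.fst_add, Prod.fst_add, lowEnd_apply, psi0_apply,
      upEnd_apply, blkP_apply, fst_apply_inl_eq hT]
    simp only [add_zero]
    exact add_comm _ _
  · rw [Prod.snd_add, LinearMap.add_apply, LinearMap.add_apply, Prod.snd_add, Prod.snd_add, lowEnd_apply, psi0_apply,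
      upEnd_apply, blkD_apply, flat_formOfSkew (blkΦ_skew hT), blkΦ_apply]
    simp only [zero_add]
    exact add_comm _ _

omit [FiniteDimensional ℂ E] in
/-- For `T ∈ 𝔰𝔲`: the block `V^* → V` is `J`-compatible, `P J^* = -J P`. [cite: LooijengaLunts1997, §3 (3.4)] -/
theorem blkP_cxJt (hT : T ∈ su E) (ξ : E →L[ℝ] ℝ) : blkP T (cxJt E ξ) = -(I • blkP T ξ) := by
  have h := congrArg (fun S : Module.End ℝ (sumDual E) ↦ (S (0, ξ)).1) hT.2.1
  have hneg : T (0, -cxJt E ξ) = -T (0, cxJt E ξ) := by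
    rw [show ((0 : E), -cxJt E ξ) = -((0 : E), cxJt E ξ) by rw [Prod.neg_mk, neg_zero], map_neg]
  simp only [Module.End.mul_apply, cxStr_apply, smul_zero, hneg, Prod.fst_neg] at h
  rw [blkP_apply, blkP_apply, ← h, neg_neg]

omit [FiniteDimensional ℂ E] in
/-- For `T ∈ 𝔰𝔲`: the block `V^* → V^*` commutes with `J^*`. [cite: LooijengaLunts1997, §3 (3.4)] -/
theorem blkD_cxJt (hT : T ∈ su E) (ξ : E →L[ℝ] ℝ) : blkD T (cxJt E ξ) = cxJt E (blkD T ξ) := by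
  have h := congrArg (fun S : Module.End ℝ (sumDual E) ↦ (S (0, ξ)).2) hT.2.1
  have hneg : T (0, -cxJt E ξ) = -T (0, cxJt E ξ) := by
    rw [show ((0 : E), -cxJt E ξ) = -((0 : E), cxJt E ξ) by rw [Prod.neg_mk, neg_zero], map_neg]
  simp only [Module.End.mul_apply, cxStr_apply, smul_zero, hneg, Prod.snd_neg] at h
  rw [blkD_apply, blkD_apply]
  exact neg_inj.1 h

omit [FiniteDimensional ℂ E] in
/-- For `T ∈ 𝔰𝔲`: the block `V → V^*` satisfies `Φ(Jv) = -J^* Φ(v)`, so its `2`-form is a real `(1,1)`-form.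
[cite: LooijengaLunts1997, §3 (3.4)] -/
theorem blkΦ_I_smul (hT : T ∈ su E) (v : E) : blkΦ T (I • v) = -cxJt E (blkΦ T v) := by
  have h := congrArg (fun S : Module.End ℝ (sumDual E) ↦ (S (v, 0)).2) hT.2.1
  simp only [Module.End.mul_apply, cxStr_apply, map_zero, neg_zero] at h
  rw [blkΦ_apply, blkΦ_apply, h]

/-- The `2`-form of the degree-`2` block of `T ∈ 𝔰𝔲` is a real `(1,1)`-form. [cite: LooijengaLunts1997, §3 (3.4)] -/
theorem formOfSkew_blkΦ_I_smul (hT : T ∈ su E) (u v : E) :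
    formOfSkew (blkΦ T) ![I • u, I • v] = formOfSkew (blkΦ T) ![u, v] :=
  formOfSkew_I_smul (blkΦ_skew (su_le_so E hT)) (blkΦ_I_smul hT) u v

variable (E) in
/-- `(J^*)^* = J`. [cite: Lang2002, III §6] -/
theorem dualTranspose_cxJt : dualTranspose E (cxJt E) = cxJ E := by
  refine LinearMap.ext fun v ↦ ?_
  have h0 : dualTranspose E (cxJt E) v - cxJ E v = 0 :=
    eq_zero_of_forall_apply_eq_zero E fun ζ ↦ by rw [map_sub, apply_dualTranspose, cxJt_apply, cxJ_apply, sub_self]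
  exact sub_eq_zero.1 h0

variable (E) in
/-- `(σ τ)^* = τ^* σ^*`. [cite: Lang2002, III §6] -/
theorem dualTranspose_mul (σ τ : Module.End ℝ (E →L[ℝ] ℝ)) :
    dualTranspose E (σ * τ) = dualTranspose E τ * dualTranspose E σ := by
  refine LinearMap.ext fun v ↦ ?_
  have h0 : dualTranspose E (σ * τ) v - dualTranspose E τ (dualTranspose E σ v) = 0 :=
    eq_zero_of_forall_apply_eq_zero E fun ζ ↦ by
      rw [map_sub, apply_dualTranspose, apply_dualTranspose, apply_dualTranspose, Module.End.mul_apply, sub_self]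
  exact sub_eq_zero.1 h0

variable (E) in
/-- `Tr σ^* = Tr σ`. [cite: Lang2002, XIII §3] -/
theorem trace_dualTranspose (σ : Module.End ℝ (E →L[ℝ] ℝ)) :
    LinearMap.trace ℝ E (dualTranspose E σ) = LinearMap.trace ℝ (E →L[ℝ] ℝ) σ := by
  classical
  set b := Module.finBasis ℝ E
  rw [LinearMap.trace_eq_matrix_trace ℝ b, Matrix.trace, trace_eq_sum_apply E b σ]
  refine Finset.sum_congr rfl fun i _ ↦ ?_
  rw [Matrix.diag_apply, LinearMap.toMatrix_apply, ← coordCLM_apply, apply_dualTranspose]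

/-- **For `T ∈ 𝔰𝔲` the block `σ : V^* → V^*` has `Tr_ℝ(J^* σ) = 0`** (`Tr_ℝ(𝒥 T) = Tr_ℝ(𝒥 ψ₀(σ)) = -2 Tr_ℝ(J^* σ)`,
the `ψ±₂` blocks being traceless against `𝒥`). [cite: LooijengaLunts1997, §3 (3.4)] -/
theorem trace_cxJt_blkD (hT : T ∈ su E) : LinearMap.trace ℝ (E →L[ℝ] ℝ) (cxJt E * blkD T) = 0 := by
  have hso := su_le_so E hT
  -- `Tr(𝒥 T) = Tr(𝒥 ψ₀(σ))`
  have h1 : LinearMap.trace ℝ (sumDual E) (cxStr E * psi0 E (blkD T)) = 0 := by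
    have h := hT.2.2
    rw [eq_blocks hso, mul_add, mul_add, map_add, map_add, trace_cxStr_mul_lowEnd, trace_cxStr_mul_upEnd, zero_add,
      add_zero] at h
    exact h
  -- `𝒥 ψ₀(σ) = -(J σ^*, J^* σ)`
  have h2 : cxStr E * psi0 E (blkD T) + (cxJ E * dualTranspose E (blkD T)).prodMap (cxJt E * blkD T) = 0 := by
    refine LinearMap.ext fun x ↦ Prod.ext ?_ ?_ <;> simp
  have h3 := congrArg (LinearMap.trace ℝ (sumDual E)) h2
  rw [map_add, h1, zero_add, LinearMap.trace_prodMap', map_zero, ← dualTranspose_cxJt, ← dualTranspose_mul,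
    trace_dualTranspose, LinearMap.trace_mul_comm ℝ (blkD T)] at h3
  linarith

end Blocks

section Main

variable (E : Type*) [NormedAddCommGroup E] [NormedSpace ℂ E] [FiniteDimensional ℂ E] [Nontrivial E]

/-- **`ρ(𝔰𝔲(V ⊕ V̄^*)) ⊆ 𝔤_K(X; ℝ)`** (`g ≥ 1`): decompose `T ∈ 𝔰𝔲` into its three blocks; `ρ` of the degree-`2`
block is `e_κ` of a real `(1,1)`-form, of the degree-`-2` block is in `𝔤_K` by `spinorRepLin_lowEnd_mem_kaehlerLieAlgebra`,
of the degree-`0` block by `spinorRepLin_psi0_mem_kaehlerLieAlgebra`. [cite: LooijengaLunts1997, §3 (3.4)] -/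
theorem range_le_kaehlerLieAlgebra : (suRep E).range ≤ kaehlerLieAlgebra E := by
  intro S hS
  obtain ⟨T, hT, rfl⟩ := mem_range_suRep_iff.1 hS
  have hso := su_le_so E hT
  rw [eq_blocks hso, map_add, map_add]
  refine add_mem (add_mem ?_ ?_) ?_
  · exact spinorRepLin_lowEnd_mem_kaehlerLieAlgebra (blkP_skew hso) (blkP_cxJt hT)
  · exact spinorRepLin_psi0_mem_kaehlerLieAlgebra E (blkD_cxJt hT) (trace_cxJt_blkD hT)
  · rw [spinorRepLin_upEnd]
    exact lefschetzG_mem_kaehlerLieAlgebra (formOfSkew_blkΦ_I_smul hT)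

/-- **Looijenga–Lunts (3.4): `𝔤_K(X; ℝ) = ρ(𝔰𝔲(V ⊕ V̄^*))`** for a complex torus `X = E/Λ` of dimension `g ≥ 1`
(`V = H₁(X; ℝ) = E`). [cite: LooijengaLunts1997, §3 (3.4)] -/
theorem range_suRep_eq : (suRep E).range = kaehlerLieAlgebra E :=
  le_antisymm (range_le_kaehlerLieAlgebra E) kaehlerLieAlgebra_le_range

/-- **Looijenga–Lunts (3.4), the identification `(𝔰𝔲(V ⊕ V̄^*), u) ≅ (𝔤_K(X; ℝ), h)` of real Lie algebras**
(`g ≥ 1`; "a real form of the case `(A_{2n-1}, A_{n-1} + A_{n-1})`"), through the spinor representation.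
[cite: LooijengaLunts1997, §3 (3.4)] -/
def kaehlerLieAlgebraEquiv : suSo E ≃ₗ⁅ℝ⁆ kaehlerLieAlgebra E :=
  (LieEquiv.ofInjective (suRep E) (suRep_injective (E := E))).trans
    (LieEquiv.ofEq _ _ (congrArg SetLike.coe (range_suRep_eq E)))

/-- The identification is `T ↦ ρ(T)`. [cite: LooijengaLunts1997, §3 (3.4)] -/
@[simp]
theorem kaehlerLieAlgebraEquiv_apply (T : suSo E) :
    (kaehlerLieAlgebraEquiv E T : Module.End ℂ (GForm E ℂ)) = spinorRepLin E (T : so E) := rfl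

/-- **`u ↦ h`**: the grading element `u = (-1_V, 1_{V^*}) ∈ 𝔰𝔲(V ⊕ V̄^*)` goes to the counting operator `h` of
`H•(X, ℂ)` ("`(𝔤_K(X; ℝ), h) ≅ (𝔰𝔲(V ⊕ V̄^*), u)`"). [cite: LooijengaLunts1997, §3 (3.4)] -/
theorem kaehlerLieAlgebraEquiv_gradingElement :
    (kaehlerLieAlgebraEquiv E ⟨⟨gradingElement E, gradingElement_mem_so E⟩, gradingElement_mem_su E⟩ :
      Module.End ℂ (GForm E ℂ)) = countingG E := by
  rw [kaehlerLieAlgebraEquiv_apply]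
  exact spinorRepLin_gradingElement_eq_countingG

/-- `h ∈ 𝔤_K(X; ℝ)` (`g ≥ 1`): through the standard Kähler form `ω₀` of the complex structure.
[cite: LooijengaLunts1997, §3 (3.4)] -/
theorem countingG_mem_kaehlerLieAlgebra' : countingG E ∈ kaehlerLieAlgebra E :=
  countingG_mem_kaehlerLieAlgebra (frameForm_cxFrame_I_smul E) (isSl2Triple (frameForm_nondegenerate (cxFrame E)))

/-- **`𝔤_K(X; ℝ) ⊊ 𝔤_tot(X; ℝ)` sits inside the total Lie algebra as `ρ(𝔰𝔲) ⊆ ρ(𝔰𝔬)`.**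
[cite: LooijengaLunts1997, §3 (3.3)–(3.4)] -/
theorem kaehlerLieAlgebra_le_range_spinorRep : kaehlerLieAlgebra E ≤ (spinorRep E).range := by
  rw [← range_suRep_eq]
  rintro S ⟨T, rfl⟩
  exact ⟨(T : so E), rfl⟩

end Main

/-! ### §10 The Hodge bigrading: `𝔤_K(X)` preserves every `⊕_{p-q=d} H^{p,q}(X)`, in particular
`⊕_k H^{k,k}(X)` -/

section HodgeBigrading

open Literature.Analysis.Complex

variable {E : Type*} [NormedAddCommGroup E] [NormedSpace ℂ E]

variable (E) in
/-- **The circle action on `H•(X, ℂ)`**: pull-back of graded forms along the rotation `v ↦ e^{iθ} v` of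
`V = H₁(X; ℝ)` (the `U(1) ⊂ ℂ^*`-action whose weight spaces are the `⊕_{p-q=d} H^{p,q}(X)`; Voisin 2002 §2.3.1).
[cite: Voisin2002, §2.3.1] -/
def rotG (θ : ℝ) : Module.End ℂ (GForm E ℂ) where
  toFun ω m := (ω m).compContinuousLinearMap (rotateCLM θ)
  map_add' ω ω' := by funext m; ext v; rfl
  map_smul' c ω := by funext m; ext v; rfl

/-- `(e^{iθ})^* ω` evaluated. [cite: Voisin2002, §2.3.1] -/
@[simp]
theorem rotG_apply (θ : ℝ) (ω : GForm E ℂ) (m : ℕ) (v : Fin m → E) :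
    rotG E θ ω m v = ω m (fun i ↦ cexp (θ * I) • v i) := rfl

variable (E) in
/-- **The weight-`d` subspace `⊕_{p-q=d} H^{p,q}(X) ⊆ H•(X, ℂ)`** of the circle action:
`(e^{iθ})^* ω = e^{idθ} ω` (a `(p,q)`-form has weight `p - q`, Voisin 2002 §2.3.1; the tree's `IsOfTypeAt`).
[cite: Voisin2002, §2.3.1] -/
def weightSpace (d : ℤ) : Submodule ℂ (GForm E ℂ) where
  carrier := {ω | ∀ θ : ℝ, rotG E θ ω = cexp (d * θ * I) • ω}
  add_mem' {ω ω'} hω hω' θ := by rw [map_add, hω θ, hω' θ, smul_add]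
  zero_mem' θ := by rw [map_zero, smul_zero]
  smul_mem' c ω hω θ := by rw [map_smul, hω θ, smul_comm]

/-- Membership in the weight-`d` subspace, evaluated. [cite: Voisin2002, §2.3.1] -/
theorem mem_weightSpace_iff {d : ℤ} {ω : GForm E ℂ} :
    ω ∈ weightSpace E d ↔
      ∀ (m : ℕ) (θ : ℝ) (v : Fin m → E), ω m (fun i ↦ cexp (θ * I) • v i) = cexp (d * θ * I) * ω m v := by
  constructor
  · intro h m θ v
    have e := congr_fun (h θ) m
    rw [Pi.smul_apply] at e
    have e' := DFunLike.congr_fun e v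
    rwa [rotG_apply, ContinuousAlternatingMap.smul_apply, smul_eq_mul] at e'
  · intro h θ
    funext m
    ext v
    rw [rotG_apply, Pi.smul_apply, ContinuousAlternatingMap.smul_apply, smul_eq_mul, h]

/-- A homogeneous form of type `(p, q)` lies in the weight space `p - q`. [cite: Voisin2002, §2.3.1] -/
theorem of_mem_weightSpace_of_isOfTypeAt {k p q : ℕ} {φ : E [⋀^Fin k]→L[ℝ] ℂ} (hφ : IsOfTypeAt p q φ) :
    GForm.of k φ ∈ weightSpace E ((p : ℤ) - q) := by
  rw [mem_weightSpace_iff]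
  intro m θ v
  rcases eq_or_ne m k with rfl | hm
  · rw [GForm.of_apply_self]
    exact hφ.2 θ v
  · rw [GForm.of_apply_of_ne hm]
    simp

variable (E) in
/-- **The commutant of the circle action** in the real Lie algebra `𝔤𝔩(H•(X, ℂ))`: the operators commuting
with every `(e^{iθ})^*`. [cite: Voisin2002, §2.3.1] -/
def rotCommutant : LieSubalgebra ℝ (Module.End ℂ (GForm E ℂ)) where
  carrier := {T | ∀ (θ : ℝ) (ω : GForm E ℂ), T (rotG E θ ω) = rotG E θ (T ω)}
  add_mem' {S T} hS hT θ ω := by rw [LinearMap.add_apply, LinearMap.add_apply, map_add, hS, hT]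
  zero_mem' θ ω := by rw [LinearMap.zero_apply, LinearMap.zero_apply, map_zero]
  smul_mem' c T hT θ ω := by rw [LinearMap.smul_apply, LinearMap.smul_apply, hT, LinearMap.map_smul_of_tower]
  lie_mem' {S T} hS hT θ ω := by
    rw [LieRing.of_associative_ring_bracket, LinearMap.sub_apply, LinearMap.sub_apply, Module.End.mul_apply,
      Module.End.mul_apply, Module.End.mul_apply, Module.End.mul_apply, hT, hS, hS, hT, ← map_sub]

/-- An operator commuting with the circle action preserves every weight space. [cite: Voisin2002, §2.3.1] -/
theorem rotCommutant_le_stabilizer_weightSpace (d : ℤ) : rotCommutant E ≤ stabilizer (weightSpace E d) := by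
  intro T hT ω hω θ
  rw [← hT θ ω, hω θ, map_smul]

variable {η : E [⋀^Fin 2]→L[ℝ] ℝ}

/-- A real `(1,1)`-form is invariant under the rotations `e^{iθ}`. [cite: Voisin2002, §2.3.1] -/
theorem twoForm_rotateCLM (h11 : ∀ u v : E, η ![I • u, I • v] = η ![u, v]) (θ : ℝ) (u v : E) :
    η ![rotateCLM θ u, rotateCLM θ v] = η ![u, v] := by
  have h := (isOfTypeAt_one_one_ofRealForm h11).2 θ ![u, v]
  have e : (fun i ↦ cexp (θ * I) • (![u, v] : Fin 2 → E) i) = ![rotateCLM θ u, rotateCLM θ v] := by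
    funext i; fin_cases i <;> rfl
  rw [e, ofRealForm_apply, ofRealForm_apply] at h
  have h0 : cexp ((((1 : ℕ) : ℤ) - (1 : ℕ) : ℤ) * θ * I) = 1 := by
    rw [Nat.cast_one, sub_self, Int.cast_zero, zero_mul, zero_mul, Complex.exp_zero]
  rw [h0, one_mul] at h
  exact_mod_cast h

/-- `Lʳ` commutes with the rotations when `η` is of type `(1,1)`. [cite: Voisin2002, §6.2.2 Rem. 6.23] -/
theorem lefschetzPow_compContinuousLinearMap_rotateCLM (h11 : ∀ u v : E, η ![I • u, I • v] = η ![u, v])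
    (θ : ℝ) (r : ℕ) {m k : ℕ} (h : 2 * r + m = k) (ψ : E [⋀^Fin m]→L[ℝ] ℂ) :
    lefschetzPow η r h (ψ.compContinuousLinearMap (rotateCLM θ)) =
      (lefschetzPow η r h ψ).compContinuousLinearMap (rotateCLM θ) := by
  rw [lefschetzPow_apply, lefschetzPow_apply, ContinuousAlternatingMap.domDomCongr_compContinuousLinearMap,
    ContinuousAlternatingMap.wedge_compContinuousLinearMap,
    wedgePow_compContinuousLinearMap_of_preserves (twoForm_rotateCLM h11 θ)]

/-- **`e_η = L_η` commutes with the circle action** for a real `(1,1)`-form `η` (bidegree `(1,1)`).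
[cite: Voisin2002, §6.2.2 Rem. 6.23] -/
theorem lefschetzG_mem_rotCommutant (h11 : ∀ u v : E, η ![I • u, I • v] = η ![u, v]) :
    lefschetzG η ∈ rotCommutant E := by
  intro θ ω
  funext m
  match m with
  | 0 => ext v; rw [lefschetzG_apply_zero, rotG_apply, lefschetzG_apply_zero]; rfl
  | 1 => ext v; rw [lefschetzG_apply_one, rotG_apply, lefschetzG_apply_one]; rfl
  | m + 2 =>
    rw [lefschetzG_apply_add_two]
    exact lefschetzPow_compContinuousLinearMap_rotateCLM h11 θ 1 _ (ω m)

variable [FiniteDimensional ℂ E]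

/-- **`f_η = Λ_η` commutes with the circle action** for a non-degenerate real `(1,1)`-form `η` (bidegree
`(-1,-1)`: the rotation `e^{iθ}` preserves `η`, and `Λ` is equivariant under `η`-preserving automorphisms,
the tree's `lefschetzDual_compContinuousLinearMap`). [cite: Voisin2002, §6.2.2 Rem. 6.23] -/
theorem lefschetzDualG_mem_rotCommutant (h11 : ∀ u v : E, η ![I • u, I • v] = η ![u, v])
    (hnd : ∀ v : E, v ≠ 0 → ∃ w : E, η ![v, w] ≠ 0) : lefschetzDualG η ∈ rotCommutant E := by
  haveI : FiniteDimensional ℝ E := FiniteDimensional.complexToReal E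
  intro θ ω
  obtain ⟨c, hc⟩ : ∃ c : ℂ, c = cexp (θ * I) := ⟨_, rfl⟩
  have hc0 : c ≠ 0 := hc ▸ Complex.exp_ne_zero _
  let T : E ≃L[ℝ] E := ((LinearEquiv.smulOfNeZero ℂ E c hc0).restrictScalars ℝ).toContinuousLinearEquiv
  have hTe : (rotateCLM θ : E →L[ℝ] E) = (T : E →L[ℝ] E) := by
    ext v
    rw [rotateCLM_apply, ContinuousLinearEquiv.coe_coe, ← hc]; rfl
  have hT : ∀ u v : E, η ![T u, T v] = η ![u, v] := fun u v ↦ by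
    have h := twoForm_rotateCLM h11 θ u v
    rwa [hTe] at h
  funext m
  change lefschetzDual η m ((ω (m + 2)).compContinuousLinearMap (rotateCLM θ)) =
    (lefschetzDual η m (ω (m + 2))).compContinuousLinearMap (rotateCLM θ)
  rw [hTe, lefschetzDual_compContinuousLinearMap hnd T hT]

/-- **`𝔤_K(X; ℝ)` commutes with the circle action of the complex structure.** [cite: LooijengaLunts1997, §1 (1.9)] -/
theorem kaehlerLieAlgebra_le_rotCommutant [Nontrivial E] : kaehlerLieAlgebra E ≤ rotCommutant E := by
  rw [kaehlerLieAlgebra, LieSubalgebra.lieSpan_le]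
  rintro T ⟨η, h11, rfl | t⟩
  · exact lefschetzG_mem_rotCommutant h11
  · obtain ⟨hnd, rfl⟩ := isSl2Triple_iff.1 t
    exact lefschetzDualG_mem_rotCommutant h11 hnd

/-- **`𝔤_K(X; ℝ)` preserves every `⊕_{p-q=d} H^{p,q}(X)`** (the Hodge bigrading up to the Lefschetz shift).
[cite: LooijengaLunts1997, §1 (1.9)] -/
theorem kaehlerLieAlgebra_le_stabilizer_weightSpace [Nontrivial E] (d : ℤ) :
    kaehlerLieAlgebra E ≤ stabilizer (weightSpace E d) :=
  kaehlerLieAlgebra_le_rotCommutant.trans (rotCommutant_le_stabilizer_weightSpace d)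

omit [FiniteDimensional ℂ E] in
variable (E) in
/-- **`⊕_k H^{k,k}(X) ⊆ H•(X, ℂ)`**, the circle-invariant graded forms (weight `0`).
[cite: LooijengaLunts1997, §3 (3.4)] -/
def hodgeDiagonal : Submodule ℂ (GForm E ℂ) := weightSpace E 0

omit [FiniteDimensional ℂ E] in
/-- A weight-`0` form of odd degree vanishes (`ω(-v) = -ω(v)` by multilinearity). [folklore] -/
private theorem eq_zero_of_weight_zero_odd {j : ℕ} {φ : E [⋀^Fin (2 * j + 1)]→L[ℝ] ℂ}
    (h : ∀ (θ : ℝ) (v : Fin (2 * j + 1) → E), φ (fun i ↦ cexp (θ * I) • v i) = φ v) : φ = 0 := by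
  ext v
  have h1 := h Real.pi v
  have e : (fun i ↦ cexp (Real.pi * I) • v i) = fun i ↦ (-1 : ℝ) • v i := by
    funext i; rw [Complex.exp_pi_mul_I, neg_one_smul, neg_one_smul]
  rw [e, ContinuousAlternatingMap.map_smul_univ, Finset.prod_const, Finset.card_univ, Fintype.card_fin,
    pow_succ, Even.neg_one_pow ⟨j, two_mul j⟩, one_mul, neg_one_smul] at h1
  have h2 : (2 : ℂ) * φ v = 0 := by linear_combination -h1
  simpa using h2

omit [FiniteDimensional ℂ E] in
/-- **`⊕_k H^{k,k}(X)` degree by degree**: `ω ∈ ⊕_k H^{k,k}` iff every even-degree component `ω_{2j}` is of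
type `(j, j)` and every odd-degree component vanishes. [cite: LooijengaLunts1997, §3 (3.4)] -/
theorem mem_hodgeDiagonal_iff {ω : GForm E ℂ} :
    ω ∈ hodgeDiagonal E ↔ (∀ j : ℕ, IsOfTypeAt j j (ω (j + j))) ∧ ∀ j : ℕ, ω (2 * j + 1) = 0 := by
  rw [hodgeDiagonal, mem_weightSpace_iff]
  simp only [Int.cast_zero, zero_mul, Complex.exp_zero, one_mul]
  refine ⟨fun h ↦ ⟨fun j ↦ ⟨rfl, fun θ v ↦ ?_⟩, fun j ↦ eq_zero_of_weight_zero_odd (h (2 * j + 1))⟩,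
    fun h m θ v ↦ ?_⟩
  · rw [h, sub_self, Int.cast_zero, zero_mul, zero_mul, Complex.exp_zero, one_mul]
  · obtain ⟨j, rfl⟩ | ⟨j, rfl⟩ := Nat.even_or_odd m
    · have e := (h.1 j).2 θ v
      rwa [sub_self, Int.cast_zero, zero_mul, zero_mul, Complex.exp_zero, one_mul] at e
    · rw [h.2 j]; rfl

omit [FiniteDimensional ℂ E] in
/-- `H⁰(X) = H^{0,0}(X) ⊆ ⊕_k H^{k,k}(X)` (the lowest-degree piece `M_{-n}`, one-dimensional).
[cite: LooijengaLunts1997, §3 (3.4)] -/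
theorem of_zero_mem_hodgeDiagonal (c : E [⋀^Fin 0]→L[ℝ] ℂ) : GForm.of 0 c ∈ hodgeDiagonal E := by
  have h := of_mem_weightSpace_of_isOfTypeAt (isOfTypeAt_zero_zero c)
  rwa [Nat.cast_zero, sub_self] at h

omit [FiniteDimensional ℂ E] in
/-- A homogeneous `(p,p)`-form lies in `⊕_k H^{k,k}(X)`. [cite: LooijengaLunts1997, §3 (3.4)] -/
theorem of_mem_hodgeDiagonal {k p : ℕ} {φ : E [⋀^Fin k]→L[ℝ] ℂ} (hφ : IsOfTypeAt p p φ) :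
    GForm.of k φ ∈ hodgeDiagonal E := by
  have h := of_mem_weightSpace_of_isOfTypeAt hφ
  rwa [sub_self] at h

/-- **`⊕_k H^{k,k}(X)` is a `𝔤_K(X)`-submodule of `H•(X, ℂ)`** (Looijenga–Lunts (3.4): "`⊕_k H^{k,k}(X)[n]` is
a [fundamental Jordan–Lefschetz] module of `𝔤_K(X)`"; the Jordan–Lefschetz property is not formalised).
[cite: LooijengaLunts1997, §3 (3.4)] -/
theorem kaehlerLieAlgebra_le_stabilizer_hodgeDiagonal [Nontrivial E] :
    kaehlerLieAlgebra E ≤ stabilizer (hodgeDiagonal E) :=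
  kaehlerLieAlgebra_le_stabilizer_weightSpace 0

/-- **The representation of `𝔤_K(X; ℝ)` on `⊕_k H^{k,k}(X)`** by restriction. [cite: LooijengaLunts1997, §3 (3.4)] -/
def hodgeDiagonalRep [Nontrivial E] : kaehlerLieAlgebra E →ₗ⁅ℝ⁆ Module.End ℂ (hodgeDiagonal E) :=
  { toFun := fun T ↦ (T : Module.End ℂ (GForm E ℂ)).restrict
      fun ω hω ↦ kaehlerLieAlgebra_le_stabilizer_hodgeDiagonal T.2 ω hω
    map_add' := fun _ _ ↦ LinearMap.ext fun _ ↦ Subtype.ext rfl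
    map_smul' := fun _ _ ↦ LinearMap.ext fun _ ↦ Subtype.ext rfl
    map_lie' := fun {_ _} ↦ LinearMap.ext fun _ ↦ Subtype.ext rfl }

/-- The restricted action, evaluated. [cite: LooijengaLunts1997, §3 (3.4)] -/
@[simp]
theorem hodgeDiagonalRep_apply_coe [Nontrivial E] (T : kaehlerLieAlgebra E) (ω : hodgeDiagonal E) :
    ((hodgeDiagonalRep T ω : hodgeDiagonal E) : GForm E ℂ) = (T : Module.End ℂ (GForm E ℂ)) ω := rfl

/-- **`𝔰𝔲(V ⊕ V̄^*)` acts on `⊕_k H^{k,k}(X)`** through the identification (3.4) `kaehlerLieAlgebraEquiv`.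
[cite: LooijengaLunts1997, §3 (3.4)] -/
def suHodgeDiagonalRep [Nontrivial E] : suSo E →ₗ⁅ℝ⁆ Module.End ℂ (hodgeDiagonal E) :=
  hodgeDiagonalRep.comp (kaehlerLieAlgebraEquiv E).toLieHom

/-- The `𝔰𝔲`-action on `⊕_k H^{k,k}(X)`, evaluated: `T · ω = ρ(T) ω`. [cite: LooijengaLunts1997, §3 (3.4)] -/
theorem suHodgeDiagonalRep_apply_coe [Nontrivial E] (T : suSo E) (ω : hodgeDiagonal E) :
    ((suHodgeDiagonalRep T ω : hodgeDiagonal E) : GForm E ℂ) = suRep E T ω := by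
  rw [suHodgeDiagonalRep, LieHom.comp_apply, hodgeDiagonalRep_apply_coe, LieEquiv.coe_toLieHom,
    kaehlerLieAlgebraEquiv_apply, suRep_apply]

/-- **`ρ(𝔰𝔲(V ⊕ V̄^*))` preserves the Hodge bigrading** of `H•(X, ℂ)` (every weight space of the circle action).
[cite: LooijengaLunts1997, §3 (3.4)] -/
theorem suRep_apply_mem_weightSpace [Nontrivial E] (T : suSo E) {d : ℤ} {ω : GForm E ℂ}
    (hω : ω ∈ weightSpace E d) : suRep E T ω ∈ weightSpace E d :=
  kaehlerLieAlgebra_le_stabilizer_weightSpace d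
    (range_suRep_eq (E := E) ▸ LieHom.mem_range_self _ T) ω hω

end HodgeBigrading

end ComplexTorus

end Literature.Geometry.Kaehler
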